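import Literature.NumberTheory.Automorphic.SymplecticRankOneSatakeClassical
import HarnessLib

/-!
# The unipotent radical of the Borel subgroup of `Sp_{2n}(K)`: root-group coordinates (Siegel part `u(C)`, `C` symmetric;
# Levi columns `m(1 + N_k(c))`), integral points and their `t_μ`-conjugates, generation, normalisation, disjointness
# (Andrianov–Zhuravlev Ch. 1 §3, Ch. 3 §3; Macdonald V (2.6); Laumon (4.1.3)–(4.1.4))

Topic `NumberTheory/Automorphic`; namespace `Literature.NumberTheory.Automorphic.SymplecticCartan` (lane `lit-hodgefound`,
Track 2 foundations; seat `lit-hodgefound-p11`, generation 45, row g45-#3).  DEFINITIONS WITH BODIES (`symplecticUnipotent`,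
`siegelLowerHom`, `leviColumnNil`, `leviColumnHom`, `siegelLowerBall`, `leviColumnBall`) + theorems; no named fact, no
instance, no notation.  Sequel of `SymplecticGroupIwasawa` (`symplecticBorel`: block-triangular symplectic matrices for the
Borel order `inr 0 < ⋯ < inr (n-1) < inl (n-1) < ⋯ < inl 0`), `SymplecticGroupIwasawaExponents` (the diagonal of a Borel
element), `SymplecticSatakeTransformDuality` (the torus elements `t_μ = diag(ϖ^μ; ϖ^{-μ})` and the entry formula of
`t_μ`-conjugation) and `SymplecticRankOneSatakeClassical` (g45-#2: `u(C) ∈ Sp` for `C` symmetric).  This file sets up the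
structure of `U(𝒪) = U(K) ∩ Sp_{2n}(𝒪)` needed to EVALUATE the modulus index `[B(𝒪) : B(𝒪) ∩ t_μB(𝒪)t_μ⁻¹]` of g44-#4 root
group by root group (the sequel `SymplecticBorelModulusIndex`, g45-#4).

## The mathematics

Let `B(K) ≤ Sp_{2n}(K)` be the Borel subgroup of the tree (`g = (A 0; C D)` in the `(inl, inr)`-block display, `D` upper
triangular, `A = ᵗD⁻¹`, `CᵗD` symmetric) and `U(K) = {g ∈ B(K) : g_{inr i, inr i} = 1 ∀ i}` its unipotent radical
(`symplecticUnipotent`; then also `g_{inl i, inl i} = 1`).  `U(K) = U_M(K) ⋉ N(K)` with `N(K) = {u(C) = (1 0; C 1) : ᵗC = C}`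
the unipotent radical of the (lower) Siegel parabolic — a vector group `Sym_n(K)`, coordinatised by the entries `C_{ab}`,
`a ≤ b` (`siegelLowerHom : (Fin n × Fin n → K) →* Sp_{2n}(K)`, `c ↦ u(S(c))`, `S(c)_{ab} = c(min, max)`) — and
`U_M(K) = {m(D) = (ᵗD⁻¹ 0; 0 D) : D upper unitriangular}`, generated by the COLUMN groups
`m(1 + N_k(c))`, `N_k(c) = Σ_{a<k} c_a E_{ak}` (`leviColumnHom k : (Fin n → K) →* Sp_{2n}(K)`; `(1 + N_k(c))⁻¹ = 1 - N_k(c)`,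
so `m(1 + N_k(c)) = (1 - ᵗN_k(c) 0; 0 1 + N_k(c))` explicitly), vector groups `K^k`.  For a weight `ν ∈ ℤⁿ` put
`N(ν) = {u(C) : v(C_{ab}) ≤ exp(ν_a + ν_b)}` (`siegelLowerBall ν`), `X_k(ν) = {m(1 + N_k(c)) : v(c_a) ≤ exp(ν_a - ν_k)}`
(`leviColumnBall k ν`) and `U(ν) = N(ν) ⊔ ⨆_k X_k(ν)`.  Then:
* `U(0) = U(K) ∩ Sp_{2n}(𝒪)` (**`unipotentInt_eq_sup`**: an integral unipotent `g = (A 0; C D)` is `u(CᵗD) · m(D)` with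
  `CᵗD` symmetric integral (the symplectic identities `AᵗD = 1`, `CᵗD = DᵗC`), and `m(D) = m(1 + N_k(col_k D)) · m(D - N_k)`
  peels the columns of the integral unitriangular `D` one at a time);
* `t_μ U(ν) t_μ⁻¹ = U(ν + μ)` (**`conjAct_smul_unipotentBall`**: conjugation by `t_μ = diag(ϖ^μ; ϖ^{-μ})` multiplies `C_{ab}`
  by `ϖ^{-μ_a-μ_b}` and `c_a` (column `k`) by `ϖ^{μ_k-μ_a}`), so for `μ` antidominant (`μ` monotone, `μ ≤ 0`)
  `t_μU(𝒪)t_μ⁻¹ = U(μ) ≤ U(0) = U(𝒪)`;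
* NORMALISATION: `X_j(ν)` normalises `X_k(ν)` for `j < k` (`m(1+N_j(c')) m(1+N_k(c)) m(1+N_j(c'))⁻¹ = m(1 + N_k(c + c_j c'|_{<j}))`,
  radii add up: `(ν_a - ν_j) + (ν_j - ν_k) = ν_a - ν_k`) and the Levi part normalises `N(ν)` (`m(D)u(C)m(D)⁻¹ = u(DCᵗD)`,
  `v((DCᵗD)_{ab}) ≤ exp(ν_a + ν_b)` by the ultrametric inequality);
* DISJOINTNESS: elements of `⨆_{j<k} X_j(ν)` have `C = 0` and trivial `D`-columns `≥ k`, so `(⨆_{j<k} X_j) ∩ X_k = 1` and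
  `(⨆_j X_j) ∩ N = 1`;
* TORUS REMOVAL: `B(𝒪) ⊆ U(𝒪) · t_μB(𝒪)t_μ⁻¹` (`g = (g d⁻¹) d`, `d` the diagonal of `g`) and
  `U(𝒪) ∩ t_μB(𝒪)t_μ⁻¹ = U(𝒪) ∩ t_μU(𝒪)t_μ⁻¹` (conjugation by `t_μ` preserves the diagonal).
These are exactly the inputs of the dévissage `[A' : A] = [Q' : Q]·[N' : N]` of `SubgroupIndexDevissage` (g45-#1).

## What is formalised

* §1 `symplecticUnipotent` (def), `mem_symplecticUnipotent_iff`, `symplecticUnipotent_le_symplecticBorel`,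
  `apply_inl_eq_one_of_mem_symplecticUnipotent`.
* §2 `toBlocks_mul_transpose_of_mem_symplecticGroup` (`AᵗD - BᵗC = 1`, `DᵗC = CᵗD`),
  `toBlocks₁₁_mul_transpose_toBlocks₂₂_of_mem_symplecticBorel` (`AᵗD = 1 = ᵗD A` on `B(K)`).
* §3 `siegelLowerHom` (def), `coe_siegelLowerHom`, `siegelLowerHom_apply_inr_inl(')`, `apply_eq_zero_of_siegelLowerHom_eq_one`,
  `siegelLowerHom_mem_symplecticUnipotent`, `siegelLowerHom_apply_inr_inr`.
* §4 `leviColumnNil` (def), `leviColumnNil_add/_zero`, `leviColumnNil_mul_leviColumnNil_of_le` (`N_k N_j = 0`, `j ≤ k`),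
  `leviColumnNil_mul_leviColumnNil_of_lt` (`N_j N_k = N_k(c'c_j)`, `j < k`), `leviColumnHom` (def), `coe_leviColumnHom`,
  `leviColumnHom_apply_inr_inr/_inl_inl/_inr_inl/_inr_inr_of_lt`, `apply_eq_zero_of_leviColumnHom_eq_one`,
  `leviColumnHom_mem_symplecticUnipotent`.
* §5 `v_uniformizer_zpow_mul_le_one_iff`, `siegelLowerHom_mem_symplecticInt_iff`, `leviColumnHom_mem_symplecticInt_iff`,
  **`conj_siegelLowerHom`**, **`conj_leviColumnHom`** (`t_μ`-conjugation scales the coordinates),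
  `siegelLowerHom_mem_conjAct_borelInt_iff`, `leviColumnHom_mem_conjAct_borelInt_iff`, `siegelLowerBall`, `leviColumnBall`
  (defs), `mem_siegelLowerBall_iff`, `mem_leviColumnBall_iff`, `…_mem_…Ball`, `…Ball_le_symplecticUnipotent`, `…Ball_mono`,
  `siegelLowerBall_le_borelInt`, `leviColumnBall_le_borelInt`, **`conjAct_smul_siegelLowerBall`**,
  **`conjAct_smul_leviColumnBall`** (`t_μ N(ν) t_μ⁻¹ = N(ν + μ)`, `t_μ X_k(ν) t_μ⁻¹ = X_k(ν + μ)`).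
* §6 **`leviColumnHom_mul_leviColumnHom_of_lt`** (the commutator relation), `v_one_add_leviColumnNil_apply_le`,
  `v_mul_apply_le_exp` (ultrametric product bound), **`leviColumnBall_le_normalizer_leviColumnBall`**,
  **`mul_siegelLowerHom_of_blocks_eq_zero`** (`m(D)u(C) = u(DCᵗD)m(D)`), **`leviColumnBall_le_normalizer_siegelLowerBall`**,
  `iSup_leviColumnBall_le_normalizer_leviColumnBall`, `iSup_leviColumnBall_le_normalizer_siegelLowerBall`.
* §7 `apply_of_mem_iSup_leviColumnBall`, `leviColumnHom_eq_one_of_forall`, `siegelLowerHom_eq_one_of_forall`,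
  **`iSup_leviColumnBall_inf_leviColumnBall_eq_bot`**, **`iSup_leviColumnBall_inf_siegelLowerBall_eq_bot`**.
* §8 `exists_siegelLowerHom_inv_mul_apply_eq_zero`, `leviColumnHom_inv_mul_apply_inr`,
  `mem_iSup_leviColumnBall_of_columns_trivial`, **`unipotentInt_eq_sup`** (`U(𝒪) = N(0) ⊔ ⨆_k X_k(0)`).
* §9 **`borelInt_subset_unipotentInt_mul_conjAct`**, **`unipotentInt_inf_conjAct_borelInt_eq`**, `conjAct_smul_unipotentInt_le`,
  `conjAct_smul_unipotentBall`, **`conjAct_smul_unipotentInt_eq`** (`t_μU(𝒪)t_μ⁻¹ = N(μ) ⊔ ⨆_k X_k(μ)`).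

## References
* [AndrianovZhuravlev1995] A. N. Andrianov, V. G. Zhuravlev, *Modular Forms and Hecke Operators*, Transl. Math. Monogr. 145
  (1995), Ch. 1 §3 Prop. 3.7 (parabolic subgroups of `Sp_n`, the matrices `U(S) = (E 0; S E)`, `(ᵗD⁻¹ 0; 0 D)`), Ch. 3 §3
  Lemma 3.4, §3.3 (3.44)–(3.49).
* [Macdonald1995] I. G. Macdonald, *Symmetric Functions and Hall Polynomials*, 2nd ed. (1995), Ch. V (2.6)–(2.7).
* [Laumon1995] G. Laumon, *Cohomology of Drinfeld Modular Varieties I*, CUP (1996), (4.1.3)–(4.1.4).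
* [CartierCorvallis1979] P. Cartier, *Representations of 𝔭-adic groups: a survey*, PSPM 33.1 (1979), §I.3, §IV (4.2).
* [BruhatTits1972] F. Bruhat, J. Tits, *Groupes réductifs sur un corps local I*, Publ. Math. IHÉS 41 (1972), (4.4.3)–(4.4.4),
  §6.1 (root group filtrations).
-/

noncomputable section

open scoped Valued WithZero Pointwise
open Matrix MulAction ConjAct

namespace Literature.NumberTheory.Automorphic.SymplecticCartan

open Literature.NumberTheory.Automorphic.CartanUnique Literature.NumberTheory.Automorphic.HermitianLattice

variable {K : Type*} [Field K] {n : ℕ}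

/-! ## §1 The unipotent radical `U(K)` of `B(K)`: unit-diagonal Borel elements -/

/-- **The unipotent radical `U(K)` of the Borel subgroup `B(K) ≤ Sp_{2n}(K)`**: Borel elements with unit diagonal
(`g_{inr i, inr i} = 1` for all `i`; then `g_{inl i, inl i} = 1` too, `apply_inl_eq_one_of_mem_symplecticUnipotent`).
[cite: AndrianovZhuravlev1995, Ch. 1 §3 Prop. 3.7] [cite: Macdonald1995, Ch. V (2.6)] -/
def symplecticUnipotent (n : ℕ) (K : Type*) [Field K] : Subgroup (symplecticGroup (Fin n) K) where
  carrier := {g | g ∈ symplecticBorel n K ∧ ∀ i, (g : Matrix (Fin n ⊕ Fin n) (Fin n ⊕ Fin n) K) (Sum.inr i) (Sum.inr i) = 1}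
  mul_mem' {a b} ha hb := by
    refine ⟨(symplecticBorel n K).mul_mem ha.1 hb.1, fun i => ?_⟩
    rw [Submonoid.coe_mul, blockTriangular_mul_apply_self symplecticBorelOrder_injective ha.1 hb.1, ha.2, hb.2, mul_one]
  one_mem' := ⟨(symplecticBorel n K).one_mem, fun i => by
    rw [show ((1 : symplecticGroup (Fin n) K) : Matrix (Fin n ⊕ Fin n) (Fin n ⊕ Fin n) K) = 1 from rfl, Matrix.one_apply_eq]⟩
  inv_mem' {a} ha := by
    refine ⟨(symplecticBorel n K).inv_mem ha.1, fun i => ?_⟩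
    have h := blockTriangular_mul_apply_self (K := K) symplecticBorelOrder_injective ((symplecticBorel n K).inv_mem ha.1) ha.1
      (Sum.inr i)
    rw [← Submonoid.coe_mul, inv_mul_cancel, show ((1 : symplecticGroup (Fin n) K) : Matrix (Fin n ⊕ Fin n) (Fin n ⊕ Fin n) K) = 1
      from rfl, Matrix.one_apply_eq, ha.2, mul_one] at h
    exact h.symm

/-- Membership in `U(K)`. [cite: AndrianovZhuravlev1995, Ch. 1 §3 Prop. 3.7] -/
theorem mem_symplecticUnipotent_iff {g : symplecticGroup (Fin n) K} :
    g ∈ symplecticUnipotent n K ↔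
      g ∈ symplecticBorel n K ∧ ∀ i, (g : Matrix (Fin n ⊕ Fin n) (Fin n ⊕ Fin n) K) (Sum.inr i) (Sum.inr i) = 1 :=
  Iff.rfl

/-- `U(K) ≤ B(K)`. [cite: AndrianovZhuravlev1995, Ch. 1 §3 Prop. 3.7] -/
theorem symplecticUnipotent_le_symplecticBorel : symplecticUnipotent n K ≤ symplecticBorel n K := fun _ hg => hg.1

/-- The `inl`-diagonal of a unipotent element is `1` as well (`g_{inr i, inr i} g_{inl i, inl i} = 1` on `B(K)`).
[cite: AndrianovZhuravlev1995, Ch. 3 §3.3 (3.44)] -/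
theorem apply_inl_eq_one_of_mem_symplecticUnipotent {g : symplecticGroup (Fin n) K} (hg : g ∈ symplecticUnipotent n K)
    (i : Fin n) : (g : Matrix (Fin n ⊕ Fin n) (Fin n ⊕ Fin n) K) (Sum.inl i) (Sum.inl i) = 1 := by
  have h := apply_inr_mul_apply_inl_eq_one hg.1 i
  rwa [hg.2 i, one_mul] at h

/-! ## §2 Blocks of a symplectic matrix: `AᵗD - BᵗC = 1`, `DᵗC = CᵗD` -/

omit [Field K] in
/-- Reassembling a matrix on `l ⊕ l` from its four blocks. [folklore] -/
private theorem eq_fromBlocks_toBlocks {l : Type*} {R : Type*} (M : Matrix (l ⊕ l) (l ⊕ l) R) :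
    M = Matrix.fromBlocks (M.toBlocks₁₁) (M.toBlocks₁₂) (M.toBlocks₂₁) (M.toBlocks₂₂) :=
  (Matrix.fromBlocks_toBlocks M).symm

/-- **The symplectic identities in blocks**: for `g = (A B; C D) ∈ Sp(J, K)`, `AᵗD - BᵗC = 1` and `DᵗC = CᵗD`
(the `(inl, inr)` and `(inr, inr)` blocks of `g J ᵗg = J`). [cite: AndrianovZhuravlev1995, Ch. 1 §3 (3.5)–(3.6)] -/
theorem toBlocks_mul_transpose_of_mem_symplecticGroup {l : Type*} [Fintype l] [DecidableEq l]
    {g : Matrix (l ⊕ l) (l ⊕ l) K} (hg : g ∈ symplecticGroup l K) :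
    g.toBlocks₁₁ * (g.toBlocks₂₂)ᵀ - g.toBlocks₁₂ * (g.toBlocks₂₁)ᵀ = 1 ∧
      g.toBlocks₂₂ * (g.toBlocks₂₁)ᵀ = g.toBlocks₂₁ * (g.toBlocks₂₂)ᵀ := by
  have h := SymplecticGroup.mem_iff.1 hg
  conv_lhs at h => rw [eq_fromBlocks_toBlocks g]
  rw [Matrix.J, Matrix.fromBlocks_transpose, Matrix.fromBlocks_multiply, Matrix.fromBlocks_multiply] at h
  simp only [Matrix.mul_zero, Matrix.mul_one, Matrix.mul_neg, zero_add, add_zero] at h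
  obtain ⟨-, h₁₂, -, h₂₂⟩ := Matrix.fromBlocks_inj.1 h
  rw [Matrix.neg_mul] at h₁₂ h₂₂
  constructor
  · have h' := congrArg Neg.neg h₁₂
    rw [neg_add, neg_neg, neg_neg] at h'
    rw [sub_eq_add_neg, add_comm]
    exact h'
  · rw [← sub_eq_add_neg, sub_eq_zero] at h₂₂
    exact h₂₂

/-- For a Borel element (`B = 0`): **`AᵗD = 1`**, hence also `ᵗD A = 1`. [cite: AndrianovZhuravlev1995, Ch. 1 §3 Prop. 3.7] -/
theorem toBlocks₁₁_mul_transpose_toBlocks₂₂_of_mem_symplecticBorel {g : symplecticGroup (Fin n) K}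
    (hg : g ∈ symplecticBorel n K) :
    (g : Matrix (Fin n ⊕ Fin n) (Fin n ⊕ Fin n) K).toBlocks₁₁ * ((g : Matrix (Fin n ⊕ Fin n) (Fin n ⊕ Fin n) K).toBlocks₂₂)ᵀ = 1 ∧
      ((g : Matrix (Fin n ⊕ Fin n) (Fin n ⊕ Fin n) K).toBlocks₂₂)ᵀ * (g : Matrix (Fin n ⊕ Fin n) (Fin n ⊕ Fin n) K).toBlocks₁₁ = 1 := by
  have hB : (g : Matrix (Fin n ⊕ Fin n) (Fin n ⊕ Fin n) K).toBlocks₁₂ = 0 := by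
    ext i j
    exact ((blockTriangular_symplecticBorelOrder_iff _).1 (mem_symplecticBorel_iff.1 hg)).1 i j
  have h := (toBlocks_mul_transpose_of_mem_symplecticGroup g.2).1
  rw [hB, Matrix.zero_mul, sub_zero] at h
  exact ⟨h, mul_eq_one_comm.1 h⟩

/-! ## §3 The Siegel lower family `u(C) = (1 0; C 1)`, `C = S(c)` symmetric -/

/-- **The Siegel lower one-parameter family** `c ↦ u(S(c)) = (1 0; S(c) 1)`, `S(c)_{ab} = c(a, b)` for `a ≤ b` and `c(b, a)`
for `b < a` (the symmetric matrix with upper-triangle coordinates `c`; the coordinates `c(a, b)`, `b < a`, are ignored): a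
homomorphism from the vector group `K^{n × n}` onto the unipotent radical `{(1 0; C 1) : ᵗC = C}` of the lower Siegel
parabolic. [cite: AndrianovZhuravlev1995, Ch. 1 §3 Prop. 3.7 (the matrices `U(S)`)] [cite: Macdonald1995, Ch. V (2.6)] -/
def siegelLowerHom (n : ℕ) (K : Type*) [Field K] : Multiplicative (Fin n × Fin n → K) →* symplecticGroup (Fin n) K where
  toFun c := ⟨Matrix.fromBlocks (1 : Matrix (Fin n) (Fin n) K) (0 : Matrix (Fin n) (Fin n) K)
      (Matrix.of fun a b => if a ≤ b then Multiplicative.toAdd c (a, b) else Multiplicative.toAdd c (b, a)) (1 : Matrix (Fin n) (Fin n) K),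
    fromBlocks_one_zero_mem_symplecticGroup (by
      refine Matrix.IsSymm.ext fun a b => ?_
      simp only [Matrix.of_apply]
      by_cases hab : a ≤ b
      · by_cases hba : b ≤ a
        · rw [le_antisymm hab hba]
        · rw [if_pos hab, if_neg hba]
      · rw [if_neg hab, if_pos (le_of_not_ge hab)])⟩
  map_one' := Subtype.ext (by
    change Matrix.fromBlocks (1 : Matrix (Fin n) (Fin n) K) (0 : Matrix (Fin n) (Fin n) K) _ (1 : Matrix (Fin n) (Fin n) K) = 1
    rw [← Matrix.fromBlocks_one]
    congr 1
    ext a b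
    simp only [Matrix.of_apply, toAdd_one, Pi.zero_apply, ite_self, Matrix.zero_apply])
  map_mul' c c' := Subtype.ext (by
    change Matrix.fromBlocks (1 : Matrix (Fin n) (Fin n) K) (0 : Matrix (Fin n) (Fin n) K) _ (1 : Matrix (Fin n) (Fin n) K) =
      Matrix.fromBlocks (1 : Matrix (Fin n) (Fin n) K) (0 : Matrix (Fin n) (Fin n) K) _ (1 : Matrix (Fin n) (Fin n) K) *
        Matrix.fromBlocks (1 : Matrix (Fin n) (Fin n) K) (0 : Matrix (Fin n) (Fin n) K) _ (1 : Matrix (Fin n) (Fin n) K)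
    rw [fromBlocks_one_zero_mul_fromBlocks_one_zero]
    congr 1
    ext a b
    simp only [Matrix.of_apply, Matrix.add_apply, toAdd_mul, Pi.add_apply]
    split_ifs <;> rfl)

/-- Entries of `u(S(c))`: the `(inr a, inl b)` entry is `c(min, max)`, the diagonal blocks are `1`, the `(inl, inr)` block
is `0`. [cite: AndrianovZhuravlev1995, Ch. 1 §3 Prop. 3.7] -/
theorem coe_siegelLowerHom (c : Multiplicative (Fin n × Fin n → K)) :
    ((siegelLowerHom n K c : symplecticGroup (Fin n) K) : Matrix (Fin n ⊕ Fin n) (Fin n ⊕ Fin n) K) =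
      Matrix.fromBlocks (1 : Matrix (Fin n) (Fin n) K) (0 : Matrix (Fin n) (Fin n) K)
        (Matrix.of fun a b => if a ≤ b then Multiplicative.toAdd c (a, b) else Multiplicative.toAdd c (b, a))
        (1 : Matrix (Fin n) (Fin n) K) :=
  rfl

/-- `u(S(c))_{inr a, inl b} = c(a, b)` for `a ≤ b`. [cite: AndrianovZhuravlev1995, Ch. 1 §3 Prop. 3.7] -/
theorem siegelLowerHom_apply_inr_inl {c : Multiplicative (Fin n × Fin n → K)} {a b : Fin n} (hab : a ≤ b) :
    ((siegelLowerHom n K c : symplecticGroup (Fin n) K) : Matrix (Fin n ⊕ Fin n) (Fin n ⊕ Fin n) K) (Sum.inr a) (Sum.inl b) =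
      Multiplicative.toAdd c (a, b) := by
  rw [coe_siegelLowerHom, Matrix.fromBlocks_apply₂₁, Matrix.of_apply, if_pos hab]

/-- `u(S(c))_{inr b, inl a} = c(a, b)` for `a ≤ b` (symmetry). [cite: AndrianovZhuravlev1995, Ch. 1 §3 Prop. 3.7] -/
theorem siegelLowerHom_apply_inr_inl' {c : Multiplicative (Fin n × Fin n → K)} {a b : Fin n} (hab : a ≤ b) :
    ((siegelLowerHom n K c : symplecticGroup (Fin n) K) : Matrix (Fin n ⊕ Fin n) (Fin n ⊕ Fin n) K) (Sum.inr b) (Sum.inl a) =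
      Multiplicative.toAdd c (a, b) := by
  rw [coe_siegelLowerHom, Matrix.fromBlocks_apply₂₁, Matrix.of_apply]
  by_cases hba : b ≤ a
  · rw [if_pos hba, le_antisymm hab hba]
  · rw [if_neg hba]

/-- `u(S(c)) = 1` forces `c(a, b) = 0` for `a ≤ b`. [cite: AndrianovZhuravlev1995, Ch. 1 §3 Prop. 3.7] -/
theorem apply_eq_zero_of_siegelLowerHom_eq_one {c : Multiplicative (Fin n × Fin n → K)} (h : siegelLowerHom n K c = 1)
    {a b : Fin n} (hab : a ≤ b) : Multiplicative.toAdd c (a, b) = 0 := by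
  rw [← siegelLowerHom_apply_inr_inl hab, h]
  change (1 : Matrix (Fin n ⊕ Fin n) (Fin n ⊕ Fin n) K) (Sum.inr a) (Sum.inl b) = 0
  rw [Matrix.one_apply_ne Sum.inr_ne_inl]

/-- `u(S(c)) ∈ U(K)`. [cite: AndrianovZhuravlev1995, Ch. 1 §3 Prop. 3.7] -/
theorem siegelLowerHom_mem_symplecticUnipotent (c : Multiplicative (Fin n × Fin n → K)) :
    siegelLowerHom n K c ∈ symplecticUnipotent n K := by
  refine ⟨?_, fun i => ?_⟩
  · rw [mem_symplecticBorel_iff, coe_siegelLowerHom, blockTriangular_symplecticBorelOrder_iff]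
    refine ⟨fun i j => by rw [Matrix.fromBlocks_apply₁₂, Matrix.zero_apply], fun i j hij => ?_, fun i j hij => ?_⟩
    · rw [Matrix.fromBlocks_apply₂₂, Matrix.one_apply_ne (ne_of_gt hij)]
    · rw [Matrix.fromBlocks_apply₁₁, Matrix.one_apply_ne (ne_of_lt hij)]
  · rw [coe_siegelLowerHom, Matrix.fromBlocks_apply₂₂, Matrix.one_apply_eq]

/-- The `D`-block of `u(S(c))` is `1`: `u(S(c))_{inr a, inr b} = δ_{ab}`. [cite: AndrianovZhuravlev1995, Ch. 1 §3 Prop. 3.7] -/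
theorem siegelLowerHom_apply_inr_inr (c : Multiplicative (Fin n × Fin n → K)) (a b : Fin n) :
    ((siegelLowerHom n K c : symplecticGroup (Fin n) K) : Matrix (Fin n ⊕ Fin n) (Fin n ⊕ Fin n) K) (Sum.inr a) (Sum.inr b) =
      (1 : Matrix (Fin n) (Fin n) K) a b := by
  rw [coe_siegelLowerHom, Matrix.fromBlocks_apply₂₂]

/-! ## §4 The Levi column families `m(1 + N_k(c)) = (1 - ᵗN_k(c) 0; 0 1 + N_k(c))` -/

/-- The nilpotent matrix `N_k(c) = Σ_{a<k} c_a E_{ak}` supported on column `k` above the diagonal (coordinates `c_a`,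
`a ≥ k`, are ignored). [folklore] -/
def leviColumnNil (k : Fin n) (c : Fin n → K) : Matrix (Fin n) (Fin n) K :=
  Matrix.of fun a b => if b = k ∧ a < k then c a else 0

/-- Entries of `N_k(c)`. [folklore] -/
private theorem leviColumnNil_apply (k : Fin n) (c : Fin n → K) (a b : Fin n) :
    leviColumnNil k c a b = if b = k ∧ a < k then c a else 0 := rfl

/-- `N_k` is additive in the coordinates. [cite: Macdonald1995, Ch. V (2.6)] -/
theorem leviColumnNil_add (k : Fin n) (c c' : Fin n → K) : leviColumnNil k (c + c') = leviColumnNil k c + leviColumnNil k c' := by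
  ext a b
  simp only [leviColumnNil, Matrix.of_apply, Matrix.add_apply, Pi.add_apply]
  split_ifs <;> simp

/-- `N_k(0) = 0`. [cite: Macdonald1995, Ch. V (2.6)] -/
theorem leviColumnNil_zero (k : Fin n) : leviColumnNil k (0 : Fin n → K) = 0 := by
  ext a b
  simp only [leviColumnNil, Matrix.of_apply, Pi.zero_apply, ite_self, Matrix.zero_apply]

/-- **`N_k(c) N_j(c') = 0` for `j ≤ k`** (row `k` of `N_j(c')` vanishes since `k ≮ j`); in particular `N_k(c)² = 0`.
[cite: Macdonald1995, Ch. V (2.6)] -/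
theorem leviColumnNil_mul_leviColumnNil_of_le {j k : Fin n} (hjk : j ≤ k) (c c' : Fin n → K) :
    leviColumnNil k c * leviColumnNil j c' = 0 := by
  ext a b
  rw [Matrix.mul_apply, Matrix.zero_apply]
  refine Finset.sum_eq_zero fun l _ => ?_
  simp only [leviColumnNil, Matrix.of_apply]
  by_cases h1 : l = k ∧ a < k
  · rw [if_pos h1, h1.1, if_neg (fun h => absurd (lt_of_lt_of_le h.2 hjk) (lt_irrefl _)), mul_zero]
  · rw [if_neg h1, zero_mul]

/-- **`N_j(c') N_k(c) = N_k(c'')` for `j < k`** with `c''_a = c'_a c_j` for `a < j` and `0` otherwise (`E_{aj}E_{jk} = E_{ak}`).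
[cite: Macdonald1995, Ch. V (2.6)] -/
theorem leviColumnNil_mul_leviColumnNil_of_lt {j k : Fin n} (hjk : j < k) (c c' : Fin n → K) :
    leviColumnNil j c' * leviColumnNil k c = leviColumnNil k (fun a => if a < j then c' a * c j else 0) := by
  ext a b
  rw [Matrix.mul_apply, leviColumnNil_apply]
  simp only [leviColumnNil, Matrix.of_apply]
  rw [Finset.sum_eq_single j]
  · by_cases hb : b = k
    · by_cases ha : a < j
      · rw [if_pos ⟨rfl, ha⟩, if_pos ⟨hb, hjk⟩, if_pos ⟨hb, ha.trans hjk⟩, if_pos ha]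
      · rw [if_neg (fun h => ha h.2), zero_mul]
        by_cases hak : a < k
        · rw [if_pos ⟨hb, hak⟩, if_neg ha]
        · rw [if_neg (fun h => hak h.2)]
    · rw [if_neg (show ¬(b = k ∧ j < k) from fun h => hb h.1), mul_zero, if_neg (show ¬(b = k ∧ a < k) from fun h => hb h.1)]
  · intro l _ hlj
    rw [if_neg (fun h => hlj h.1), zero_mul]
  · intro h; exact absurd (Finset.mem_univ j) h

/-- **The Levi column family** `c ↦ m(1 + N_k(c)) = (1 - ᵗN_k(c) 0; 0 1 + N_k(c)) ∈ Sp_{2n}(K)` (`ᵗ(1 + N_k(c))⁻¹ = 1 - ᵗN_k(c)`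
since `N_k(c)² = 0`): a homomorphism from the vector group `K^n` (coordinates `c_a`, `a ≥ k`, ignored) onto the product of the
root groups `x_{ε_a - ε_k}`, `a < k`, of the Levi factor `m(GL_n)`. [cite: AndrianovZhuravlev1995, Ch. 1 §3 Prop. 3.7 (the
matrices `(ᵗD⁻¹ 0; 0 D)`)] [cite: Macdonald1995, Ch. V (2.6)] -/
def leviColumnHom (k : Fin n) : Multiplicative (Fin n → K) →* symplecticGroup (Fin n) K where
  toFun c := ⟨Matrix.fromBlocks (1 - (leviColumnNil k (Multiplicative.toAdd c))ᵀ) (0 : Matrix (Fin n) (Fin n) K)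
      (0 : Matrix (Fin n) (Fin n) K) (1 + leviColumnNil k (Multiplicative.toAdd c)), by
    rw [SymplecticGroup.mem_iff, Matrix.J, Matrix.fromBlocks_transpose, Matrix.fromBlocks_multiply, Matrix.fromBlocks_multiply]
    have hsq : (leviColumnNil k (Multiplicative.toAdd c))ᵀ * (leviColumnNil k (Multiplicative.toAdd c))ᵀ = 0 := by
      rw [← Matrix.transpose_mul, leviColumnNil_mul_leviColumnNil_of_le le_rfl, Matrix.transpose_zero]
    have hsq' : leviColumnNil k (Multiplicative.toAdd c) * leviColumnNil k (Multiplicative.toAdd c) = 0 :=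
      leviColumnNil_mul_leviColumnNil_of_le le_rfl _ _
    have h1 : (1 - (leviColumnNil k (Multiplicative.toAdd c))ᵀ) * (1 + leviColumnNil k (Multiplicative.toAdd c))ᵀ = 1 := by
      rw [Matrix.transpose_add, Matrix.transpose_one, mul_add, sub_mul, sub_mul, one_mul, mul_one, one_mul, hsq]; abel
    have h2 : (1 + leviColumnNil k (Multiplicative.toAdd c)) * (1 - (leviColumnNil k (Multiplicative.toAdd c))ᵀ)ᵀ = 1 := by
      rw [Matrix.transpose_sub, Matrix.transpose_one, Matrix.transpose_transpose, add_mul, mul_sub, mul_sub, one_mul, mul_one,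
        one_mul, hsq']; abel
    simp only [Matrix.mul_zero, Matrix.zero_mul, Matrix.mul_one, add_zero, zero_add, Matrix.transpose_zero, Matrix.mul_neg,
      Matrix.neg_mul, h1, h2, neg_zero]⟩
  map_one' := Subtype.ext (by
    change Matrix.fromBlocks (1 - (leviColumnNil k (Multiplicative.toAdd (1 : Multiplicative (Fin n → K))))ᵀ) (0 : Matrix (Fin n) (Fin n) K)
      (0 : Matrix (Fin n) (Fin n) K) (1 + leviColumnNil k (Multiplicative.toAdd (1 : Multiplicative (Fin n → K)))) = 1
    rw [toAdd_one, leviColumnNil_zero, Matrix.transpose_zero, sub_zero, add_zero, Matrix.fromBlocks_one])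
  map_mul' c c' := Subtype.ext (by
    change Matrix.fromBlocks (1 - (leviColumnNil k (Multiplicative.toAdd (c * c')))ᵀ) (0 : Matrix (Fin n) (Fin n) K)
        (0 : Matrix (Fin n) (Fin n) K) (1 + leviColumnNil k (Multiplicative.toAdd (c * c'))) =
      Matrix.fromBlocks (1 - (leviColumnNil k (Multiplicative.toAdd c))ᵀ) (0 : Matrix (Fin n) (Fin n) K)
          (0 : Matrix (Fin n) (Fin n) K) (1 + leviColumnNil k (Multiplicative.toAdd c)) *
        Matrix.fromBlocks (1 - (leviColumnNil k (Multiplicative.toAdd c'))ᵀ) (0 : Matrix (Fin n) (Fin n) K)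
          (0 : Matrix (Fin n) (Fin n) K) (1 + leviColumnNil k (Multiplicative.toAdd c'))
    rw [Matrix.fromBlocks_multiply, toAdd_mul, leviColumnNil_add, Matrix.transpose_add]
    have hsq : (leviColumnNil k (Multiplicative.toAdd c))ᵀ * (leviColumnNil k (Multiplicative.toAdd c'))ᵀ = 0 := by
      rw [← Matrix.transpose_mul, leviColumnNil_mul_leviColumnNil_of_le le_rfl, Matrix.transpose_zero]
    have hsq' : leviColumnNil k (Multiplicative.toAdd c) * leviColumnNil k (Multiplicative.toAdd c') = 0 :=
      leviColumnNil_mul_leviColumnNil_of_le le_rfl _ _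
    congr 1
    · simp only [Matrix.zero_mul, add_zero, sub_mul, mul_sub, one_mul, mul_one, hsq, sub_zero]; abel
    · simp
    · simp
    · simp only [Matrix.zero_mul, add_zero, add_mul, mul_add, one_mul, mul_one, hsq']; abel)

/-- The matrix of `m(1 + N_k(c))`. [cite: AndrianovZhuravlev1995, Ch. 1 §3 Prop. 3.7] -/
theorem coe_leviColumnHom (k : Fin n) (c : Multiplicative (Fin n → K)) :
    ((leviColumnHom k c : symplecticGroup (Fin n) K) : Matrix (Fin n ⊕ Fin n) (Fin n ⊕ Fin n) K) =
      Matrix.fromBlocks (1 - (leviColumnNil k (Multiplicative.toAdd c))ᵀ) (0 : Matrix (Fin n) (Fin n) K)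
        (0 : Matrix (Fin n) (Fin n) K) (1 + leviColumnNil k (Multiplicative.toAdd c)) :=
  rfl

/-- `m(1 + N_k(c))_{inr a, inr b} = δ_{ab} + [b = k, a < k] c_a`. [cite: Macdonald1995, Ch. V (2.6)] -/
theorem leviColumnHom_apply_inr_inr (k : Fin n) (c : Multiplicative (Fin n → K)) (a b : Fin n) :
    ((leviColumnHom k c : symplecticGroup (Fin n) K) : Matrix (Fin n ⊕ Fin n) (Fin n ⊕ Fin n) K) (Sum.inr a) (Sum.inr b) =
      (1 : Matrix (Fin n) (Fin n) K) a b + if b = k ∧ a < k then Multiplicative.toAdd c a else 0 := by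
  rw [coe_leviColumnHom, Matrix.fromBlocks_apply₂₂, Matrix.add_apply, leviColumnNil_apply]

/-- `m(1 + N_k(c))_{inl a, inl b} = δ_{ab} - [a = k, b < k] c_b`. [cite: Macdonald1995, Ch. V (2.6)] -/
theorem leviColumnHom_apply_inl_inl (k : Fin n) (c : Multiplicative (Fin n → K)) (a b : Fin n) :
    ((leviColumnHom k c : symplecticGroup (Fin n) K) : Matrix (Fin n ⊕ Fin n) (Fin n ⊕ Fin n) K) (Sum.inl a) (Sum.inl b) =
      (1 : Matrix (Fin n) (Fin n) K) a b - if a = k ∧ b < k then Multiplicative.toAdd c b else 0 := by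
  rw [coe_leviColumnHom, Matrix.fromBlocks_apply₁₁, Matrix.sub_apply, Matrix.transpose_apply, leviColumnNil_apply]

/-- The off-diagonal blocks of `m(1 + N_k(c))` vanish. [cite: AndrianovZhuravlev1995, Ch. 1 §3 Prop. 3.7] -/
theorem leviColumnHom_apply_inr_inl (k : Fin n) (c : Multiplicative (Fin n → K)) (a b : Fin n) :
    ((leviColumnHom k c : symplecticGroup (Fin n) K) : Matrix (Fin n ⊕ Fin n) (Fin n ⊕ Fin n) K) (Sum.inr a) (Sum.inl b) = 0 ∧
      ((leviColumnHom k c : symplecticGroup (Fin n) K) : Matrix (Fin n ⊕ Fin n) (Fin n ⊕ Fin n) K) (Sum.inl a) (Sum.inr b) = 0 := by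
  rw [coe_leviColumnHom, Matrix.fromBlocks_apply₂₁, Matrix.fromBlocks_apply₁₂, Matrix.zero_apply]
  exact ⟨rfl, rfl⟩

/-- `m(1 + N_k(c))_{inr a, inr k} = c_a` for `a < k`: the coordinates are read off column `k`.
[cite: Macdonald1995, Ch. V (2.6)] -/
theorem leviColumnHom_apply_inr_inr_of_lt (k : Fin n) (c : Multiplicative (Fin n → K)) {a : Fin n} (ha : a < k) :
    ((leviColumnHom k c : symplecticGroup (Fin n) K) : Matrix (Fin n ⊕ Fin n) (Fin n ⊕ Fin n) K) (Sum.inr a) (Sum.inr k) =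
      Multiplicative.toAdd c a := by
  rw [leviColumnHom_apply_inr_inr, Matrix.one_apply_ne (ne_of_lt ha), if_pos ⟨rfl, ha⟩, zero_add]

/-- `m(1 + N_k(c)) = 1` forces `c_a = 0` for `a < k`. [cite: Macdonald1995, Ch. V (2.6)] -/
theorem apply_eq_zero_of_leviColumnHom_eq_one {k : Fin n} {c : Multiplicative (Fin n → K)} (h : leviColumnHom k c = 1)
    {a : Fin n} (ha : a < k) : Multiplicative.toAdd c a = 0 := by
  rw [← leviColumnHom_apply_inr_inr_of_lt k c ha, h]
  change (1 : Matrix (Fin n ⊕ Fin n) (Fin n ⊕ Fin n) K) (Sum.inr a) (Sum.inr k) = 0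
  rw [Matrix.one_apply_ne (fun h => absurd (Sum.inr_injective h) (ne_of_lt ha))]

/-- `m(1 + N_k(c)) ∈ U(K)`. [cite: AndrianovZhuravlev1995, Ch. 1 §3 Prop. 3.7] -/
theorem leviColumnHom_mem_symplecticUnipotent (k : Fin n) (c : Multiplicative (Fin n → K)) :
    leviColumnHom k c ∈ symplecticUnipotent n K := by
  refine ⟨?_, fun i => ?_⟩
  · rw [mem_symplecticBorel_iff, blockTriangular_symplecticBorelOrder_iff]
    refine ⟨fun i j => (leviColumnHom_apply_inr_inl k c i j).2, fun i j hij => ?_, fun i j hij => ?_⟩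
    · rw [leviColumnHom_apply_inr_inr, Matrix.one_apply_ne (ne_of_gt hij), zero_add, if_neg]
      rintro ⟨rfl, h⟩
      exact absurd (hij.trans h) (lt_irrefl _)
    · rw [leviColumnHom_apply_inl_inl, Matrix.one_apply_ne (ne_of_lt hij), zero_sub, neg_eq_zero, if_neg]
      rintro ⟨rfl, h⟩
      exact absurd (hij.trans h) (lt_irrefl _)
  · rw [leviColumnHom_apply_inr_inr, Matrix.one_apply_eq, if_neg (fun h => absurd (h.1 ▸ h.2) (lt_irrefl _)), add_zero]

/-! ## §5 Integral points, `t_μ`-conjugation, and the balls `N(ν)`, `X_k(ν)` -/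

section Valued

variable [Valued K ℤᵐ⁰] {ϖ : K}

omit [Valued K ℤᵐ⁰] in
/-- Entries of the identity matrix are `0` or `1`. [folklore] -/
private theorem v_one_apply_le_one [Valued K ℤᵐ⁰] (a b : Fin n) : Valued.v ((1 : Matrix (Fin n) (Fin n) K) a b) ≤ 1 := by
  by_cases hab : a = b
  · rw [hab, Matrix.one_apply_eq, map_one]
  · rw [Matrix.one_apply_ne hab, map_zero]; exact zero_le

/-- `v(ϖ^m x) ≤ 1 ↔ v(x) ≤ exp(m)`. [cite: Serre1979, Ch. I §1] -/
theorem v_uniformizer_zpow_mul_le_one_iff (hϖ : Valued.v ϖ = WithZero.exp (-1 : ℤ)) (m : ℤ) (x : K) :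
    Valued.v (ϖ ^ m * x) ≤ 1 ↔ Valued.v x ≤ WithZero.exp m := by
  rw [map_mul, v_uniformizer_zpow hϖ]
  constructor
  · intro h
    have h' := mul_le_mul_right h (WithZero.exp m)
    rwa [← mul_assoc, ← WithZero.exp_add, add_neg_cancel, WithZero.exp_zero, one_mul, mul_one] at h'
  · intro h
    have h' := mul_le_mul_right h (WithZero.exp (-m))
    rwa [← WithZero.exp_add, neg_add_cancel, WithZero.exp_zero] at h'

/-- **`u(S(c)) ∈ Sp_{2n}(𝒪)` iff the coordinates `c(a, b)`, `a ≤ b`, are integral.**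
[cite: AndrianovZhuravlev1995, Ch. 3 §3 Lemma 3.4] -/
theorem siegelLowerHom_mem_symplecticInt_iff {c : Multiplicative (Fin n × Fin n → K)} :
    siegelLowerHom n K c ∈ symplecticInt (Fin n) K ↔ ∀ a b : Fin n, a ≤ b → Valued.v (Multiplicative.toAdd c (a, b)) ≤ 1 := by
  rw [mem_symplecticInt_iff, coe_siegelLowerHom]
  constructor
  · intro h a b hab
    have h' := h (Sum.inr a) (Sum.inl b)
    rwa [Matrix.fromBlocks_apply₂₁, Matrix.of_apply, if_pos hab] at h'
  · intro h
    rintro (a | a) (b | b)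
    · rw [Matrix.fromBlocks_apply₁₁]; exact v_one_apply_le_one a b
    · rw [Matrix.fromBlocks_apply₁₂, Matrix.zero_apply, map_zero]; exact zero_le
    · rw [Matrix.fromBlocks_apply₂₁, Matrix.of_apply]
      split_ifs with hab
      · exact h a b hab
      · exact h b a (le_of_not_ge hab)
    · rw [Matrix.fromBlocks_apply₂₂]; exact v_one_apply_le_one a b

/-- **`m(1 + N_k(c)) ∈ Sp_{2n}(𝒪)` iff the coordinates `c_a`, `a < k`, are integral.** [cite: AndrianovZhuravlev1995, Ch. 3 §3 Lemma 3.4] -/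
theorem leviColumnHom_mem_symplecticInt_iff {k : Fin n} {c : Multiplicative (Fin n → K)} :
    leviColumnHom k c ∈ symplecticInt (Fin n) K ↔ ∀ a : Fin n, a < k → Valued.v (Multiplicative.toAdd c a) ≤ 1 := by
  rw [mem_symplecticInt_iff]
  constructor
  · intro h a ha
    have h' := h (Sum.inr a) (Sum.inr k)
    rwa [leviColumnHom_apply_inr_inr_of_lt k c ha] at h'
  · intro h
    rintro (a | a) (b | b)
    · rw [leviColumnHom_apply_inl_inl]
      split_ifs with hc
      · obtain ⟨rfl, hb⟩ := hc
        rw [Matrix.one_apply_ne (ne_of_gt hb), zero_sub, Valuation.map_neg]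
        exact h b hb
      · rw [sub_zero]; exact v_one_apply_le_one a b
    · rw [(leviColumnHom_apply_inr_inl k c a b).2, map_zero]; exact zero_le
    · rw [(leviColumnHom_apply_inr_inl k c a b).1, map_zero]; exact zero_le
    · rw [leviColumnHom_apply_inr_inr]
      split_ifs with hc
      · obtain ⟨rfl, ha⟩ := hc
        rw [Matrix.one_apply_ne (ne_of_lt ha), zero_add]
        exact h a ha
      · rw [add_zero]; exact v_one_apply_le_one a b

omit [Valued K ℤᵐ⁰] in
/-- **`t_μ u(S(c)) t_μ⁻¹ = u(S(c'))`, `c'(a, b) = ϖ^{-μ_a-μ_b} c(a, b)`** for `t_μ = diag(ϖ^μ; ϖ^{-μ})`.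
[cite: Macdonald1995, Ch. V (2.6)] [cite: BruhatTits1972, (4.4.3)] -/
theorem conj_siegelLowerHom (hϖ0 : ϖ ≠ 0) {t : symplecticGroup (Fin n) K} {μ : Fin n → ℤ}
    (ht : (t : Matrix (Fin n ⊕ Fin n) (Fin n ⊕ Fin n) K) = Matrix.diagonal fun s => ϖ ^ Sum.elim μ (-μ) s)
    (c : Multiplicative (Fin n × Fin n → K)) :
    t * siegelLowerHom n K c * t⁻¹ =
      siegelLowerHom n K (Multiplicative.ofAdd fun p => ϖ ^ (-μ p.1 - μ p.2) * Multiplicative.toAdd c p) := by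
  refine Subtype.ext (Matrix.ext fun s s' => ?_)
  rw [coe_conj_apply_of_coe_eq_diagonal_zpow hϖ0 ht, coe_siegelLowerHom, coe_siegelLowerHom]
  rcases s with a | a <;> rcases s' with b | b
  · rw [Matrix.fromBlocks_apply₁₁, Matrix.fromBlocks_apply₁₁]
    by_cases hab : a = b
    · rw [hab, sub_self, zpow_zero, one_mul]
    · rw [Matrix.one_apply_ne hab, mul_zero]
  · rw [Matrix.fromBlocks_apply₁₂, Matrix.fromBlocks_apply₁₂, Matrix.zero_apply, mul_zero]
  · rw [Matrix.fromBlocks_apply₂₁, Matrix.fromBlocks_apply₂₁, Matrix.of_apply, Matrix.of_apply]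
    simp only [Sum.elim_inr, Sum.elim_inl, Pi.neg_apply, toAdd_ofAdd]
    by_cases hab : a ≤ b
    · rw [if_pos hab, if_pos hab]
    · rw [if_neg hab, if_neg hab, show -μ a - μ b = -μ b - μ a by ring]
  · rw [Matrix.fromBlocks_apply₂₂, Matrix.fromBlocks_apply₂₂]
    by_cases hab : a = b
    · rw [hab, sub_self, zpow_zero, one_mul]
    · rw [Matrix.one_apply_ne hab, mul_zero]

omit [Valued K ℤᵐ⁰] in
/-- **`t_μ m(1 + N_k(c)) t_μ⁻¹ = m(1 + N_k(c'))`, `c'_a = ϖ^{μ_k-μ_a} c_a`**. [cite: Macdonald1995, Ch. V (2.6)] [cite: BruhatTits1972, (4.4.3)] -/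
theorem conj_leviColumnHom (hϖ0 : ϖ ≠ 0) {t : symplecticGroup (Fin n) K} {μ : Fin n → ℤ}
    (ht : (t : Matrix (Fin n ⊕ Fin n) (Fin n ⊕ Fin n) K) = Matrix.diagonal fun s => ϖ ^ Sum.elim μ (-μ) s)
    (k : Fin n) (c : Multiplicative (Fin n → K)) :
    t * leviColumnHom k c * t⁻¹ = leviColumnHom k (Multiplicative.ofAdd fun a => ϖ ^ (μ k - μ a) * Multiplicative.toAdd c a) := by
  refine Subtype.ext (Matrix.ext fun s s' => ?_)
  rw [coe_conj_apply_of_coe_eq_diagonal_zpow hϖ0 ht]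
  rcases s with a | a <;> rcases s' with b | b
  · rw [leviColumnHom_apply_inl_inl, leviColumnHom_apply_inl_inl]
    simp only [Sum.elim_inl, toAdd_ofAdd]
    by_cases hc : a = k ∧ b < k
    · obtain ⟨rfl, hb⟩ := hc
      rw [if_pos ⟨rfl, hb⟩, if_pos ⟨rfl, hb⟩, Matrix.one_apply_ne (ne_of_gt hb), zero_sub, zero_sub, mul_neg]
    · rw [if_neg hc, if_neg hc, sub_zero]
      by_cases hab : a = b
      · rw [hab, sub_self, zpow_zero, one_mul]
      · rw [Matrix.one_apply_ne hab, mul_zero]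
  · rw [(leviColumnHom_apply_inr_inl k c a b).2, (leviColumnHom_apply_inr_inl k _ a b).2, mul_zero]
  · rw [(leviColumnHom_apply_inr_inl k c a b).1, (leviColumnHom_apply_inr_inl k _ a b).1, mul_zero]
  · rw [leviColumnHom_apply_inr_inr, leviColumnHom_apply_inr_inr]
    simp only [Sum.elim_inr, Pi.neg_apply, toAdd_ofAdd]
    by_cases hc : b = k ∧ a < k
    · obtain ⟨rfl, ha⟩ := hc
      rw [if_pos ⟨rfl, ha⟩, if_pos ⟨rfl, ha⟩, Matrix.one_apply_ne (ne_of_lt ha), zero_add, zero_add,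
        show -μ a - -μ b = μ b - μ a by ring]
    · rw [if_neg hc, if_neg hc, add_zero]
      by_cases hab : a = b
      · rw [hab, sub_self, zpow_zero, one_mul]
      · rw [Matrix.one_apply_ne hab, mul_zero]

/-- **`u(S(c)) ∈ t_μB(𝒪)t_μ⁻¹` iff `v(c(a, b)) ≤ exp(μ_a + μ_b)` for `a ≤ b`** (the conjugate `t_μ⁻¹ u(S(c)) t_μ = u(S(ϖ^{μ_a+μ_b}c))`
must be integral). [cite: CartierCorvallis1979, §IV (4.2)] [cite: Macdonald1995, Ch. V (2.6)] -/
theorem siegelLowerHom_mem_conjAct_borelInt_iff (hϖ : Valued.v ϖ = WithZero.exp (-1 : ℤ)) {t : symplecticGroup (Fin n) K}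
    {μ : Fin n → ℤ} (ht : (t : Matrix (Fin n ⊕ Fin n) (Fin n ⊕ Fin n) K) = Matrix.diagonal fun s => ϖ ^ Sum.elim μ (-μ) s)
    {c : Multiplicative (Fin n × Fin n → K)} :
    siegelLowerHom n K c ∈ toConjAct t • (symplecticBorel n K ⊓ symplecticInt (Fin n) K) ↔
      ∀ a b : Fin n, a ≤ b → Valued.v (Multiplicative.toAdd c (a, b)) ≤ WithZero.exp (μ a + μ b) := by
  rw [Subgroup.mem_pointwise_smul_iff_inv_smul_mem, ← toConjAct_inv, toConjAct_smul,
    conj_siegelLowerHom (uniformizer_ne_zero hϖ) (coe_inv_eq_diagonal_zpow_neg hϖ ht), Subgroup.mem_inf,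
    and_iff_right (siegelLowerHom_mem_symplecticUnipotent _).1, siegelLowerHom_mem_symplecticInt_iff]
  refine forall_congr' fun a => forall_congr' fun b => imp_congr_right fun _ => ?_
  rw [toAdd_ofAdd, Pi.neg_apply, Pi.neg_apply, neg_neg, sub_neg_eq_add, v_uniformizer_zpow_mul_le_one_iff hϖ]

/-- **`m(1 + N_k(c)) ∈ t_μB(𝒪)t_μ⁻¹` iff `v(c_a) ≤ exp(μ_a - μ_k)` for `a < k`.** [cite: CartierCorvallis1979, §IV (4.2)]
[cite: Macdonald1995, Ch. V (2.6)] -/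
theorem leviColumnHom_mem_conjAct_borelInt_iff (hϖ : Valued.v ϖ = WithZero.exp (-1 : ℤ)) {t : symplecticGroup (Fin n) K}
    {μ : Fin n → ℤ} (ht : (t : Matrix (Fin n ⊕ Fin n) (Fin n ⊕ Fin n) K) = Matrix.diagonal fun s => ϖ ^ Sum.elim μ (-μ) s)
    {k : Fin n} {c : Multiplicative (Fin n → K)} :
    leviColumnHom k c ∈ toConjAct t • (symplecticBorel n K ⊓ symplecticInt (Fin n) K) ↔
      ∀ a : Fin n, a < k → Valued.v (Multiplicative.toAdd c a) ≤ WithZero.exp (μ a - μ k) := by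
  rw [Subgroup.mem_pointwise_smul_iff_inv_smul_mem, ← toConjAct_inv, toConjAct_smul,
    conj_leviColumnHom (uniformizer_ne_zero hϖ) (coe_inv_eq_diagonal_zpow_neg hϖ ht), Subgroup.mem_inf,
    and_iff_right (leviColumnHom_mem_symplecticUnipotent _ _).1, leviColumnHom_mem_symplecticInt_iff]
  refine forall_congr' fun a => imp_congr_right fun _ => ?_
  rw [toAdd_ofAdd, Pi.neg_apply, Pi.neg_apply, neg_sub_neg, v_uniformizer_zpow_mul_le_one_iff hϖ]

/-- **`N(ν)`** — the integral ball of weight `ν` of the Siegel lower radical: `{u(S(c)) : v(c(a, b)) ≤ exp(ν_a + ν_b) (a ≤ b)}`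
(`ν = 0`: `N(K) ∩ Sp_{2n}(𝒪)`; `ν = μ`: its `t_μ`-conjugate). [cite: Macdonald1995, Ch. V (2.6)] [cite: BruhatTits1972, §6.1] -/
def siegelLowerBall (n : ℕ) (K : Type*) [Field K] [Valued K ℤᵐ⁰] (ν : Fin n → ℤ) : Subgroup (symplecticGroup (Fin n) K) :=
  (AddSubgroup.toSubgroup (AddSubgroup.pi Set.univ fun p : Fin n × Fin n =>
      if p.1 ≤ p.2 then (Valued.v : Valuation K ℤᵐ⁰).leAddSubgroup (WithZero.exp (ν p.1 + ν p.2)) else ⊤)).map (siegelLowerHom n K)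

/-- **`X_k(ν)`** — the integral ball of weight `ν` of the `k`-th Levi column group: `{m(1 + N_k(c)) : v(c_a) ≤ exp(ν_a - ν_k) (a < k)}`.
[cite: Macdonald1995, Ch. V (2.6)] [cite: BruhatTits1972, §6.1] -/
def leviColumnBall (n : ℕ) (K : Type*) [Field K] [Valued K ℤᵐ⁰] (k : Fin n) (ν : Fin n → ℤ) :
    Subgroup (symplecticGroup (Fin n) K) :=
  (AddSubgroup.toSubgroup (AddSubgroup.pi Set.univ fun a : Fin n =>
      if a < k then (Valued.v : Valuation K ℤᵐ⁰).leAddSubgroup (WithZero.exp (ν a - ν k)) else ⊤)).map (leviColumnHom k)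

/-- Membership in `N(ν)`. [cite: Macdonald1995, Ch. V (2.6)] -/
theorem mem_siegelLowerBall_iff {ν : Fin n → ℤ} {g : symplecticGroup (Fin n) K} :
    g ∈ siegelLowerBall n K ν ↔ ∃ c : Fin n × Fin n → K,
      (∀ a b : Fin n, a ≤ b → Valued.v (c (a, b)) ≤ WithZero.exp (ν a + ν b)) ∧ siegelLowerHom n K (Multiplicative.ofAdd c) = g := by
  rw [siegelLowerBall, Subgroup.mem_map]
  constructor
  · rintro ⟨x, hx, rfl⟩
    refine ⟨Multiplicative.toAdd x, fun a b hab => ?_, rfl⟩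
    have h := (AddSubgroup.mem_pi _).1 (show Multiplicative.toAdd x ∈ _ from hx) (a, b) (Set.mem_univ _)
    simp only [if_pos hab] at h
    exact h
  · rintro ⟨c, hc, rfl⟩
    refine ⟨Multiplicative.ofAdd c, ?_, rfl⟩
    change c ∈ AddSubgroup.pi Set.univ _
    refine (AddSubgroup.mem_pi _).2 fun p _ => ?_
    by_cases hp : p.1 ≤ p.2
    · rw [if_pos hp]; exact hc p.1 p.2 hp
    · rw [if_neg hp]; exact AddSubgroup.mem_top _

/-- Membership in `X_k(ν)`. [cite: Macdonald1995, Ch. V (2.6)] -/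
theorem mem_leviColumnBall_iff {k : Fin n} {ν : Fin n → ℤ} {g : symplecticGroup (Fin n) K} :
    g ∈ leviColumnBall n K k ν ↔ ∃ c : Fin n → K,
      (∀ a : Fin n, a < k → Valued.v (c a) ≤ WithZero.exp (ν a - ν k)) ∧ leviColumnHom k (Multiplicative.ofAdd c) = g := by
  rw [leviColumnBall, Subgroup.mem_map]
  constructor
  · rintro ⟨x, hx, rfl⟩
    refine ⟨Multiplicative.toAdd x, fun a ha => ?_, rfl⟩
    have h := (AddSubgroup.mem_pi _).1 (show Multiplicative.toAdd x ∈ _ from hx) a (Set.mem_univ _)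
    simp only [if_pos ha] at h
    exact h
  · rintro ⟨c, hc, rfl⟩
    refine ⟨Multiplicative.ofAdd c, ?_, rfl⟩
    change c ∈ AddSubgroup.pi Set.univ _
    refine (AddSubgroup.mem_pi _).2 fun a _ => ?_
    by_cases ha : a < k
    · rw [if_pos ha]; exact hc a ha
    · rw [if_neg ha]; exact AddSubgroup.mem_top _

/-- The generators of `N(ν)`. [cite: Macdonald1995, Ch. V (2.6)] -/
theorem siegelLowerHom_mem_siegelLowerBall {ν : Fin n → ℤ} {c : Fin n × Fin n → K}
    (hc : ∀ a b : Fin n, a ≤ b → Valued.v (c (a, b)) ≤ WithZero.exp (ν a + ν b)) :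
    siegelLowerHom n K (Multiplicative.ofAdd c) ∈ siegelLowerBall n K ν :=
  mem_siegelLowerBall_iff.2 ⟨c, hc, rfl⟩

/-- The generators of `X_k(ν)`. [cite: Macdonald1995, Ch. V (2.6)] -/
theorem leviColumnHom_mem_leviColumnBall {k : Fin n} {ν : Fin n → ℤ} {c : Fin n → K}
    (hc : ∀ a : Fin n, a < k → Valued.v (c a) ≤ WithZero.exp (ν a - ν k)) :
    leviColumnHom k (Multiplicative.ofAdd c) ∈ leviColumnBall n K k ν :=
  mem_leviColumnBall_iff.2 ⟨c, hc, rfl⟩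

/-- `N(ν) ≤ U(K)`. [cite: AndrianovZhuravlev1995, Ch. 1 §3 Prop. 3.7] -/
theorem siegelLowerBall_le_symplecticUnipotent (ν : Fin n → ℤ) : siegelLowerBall n K ν ≤ symplecticUnipotent n K := by
  intro g hg
  obtain ⟨c, -, rfl⟩ := mem_siegelLowerBall_iff.1 hg
  exact siegelLowerHom_mem_symplecticUnipotent _

/-- `X_k(ν) ≤ U(K)`. [cite: AndrianovZhuravlev1995, Ch. 1 §3 Prop. 3.7] -/
theorem leviColumnBall_le_symplecticUnipotent (k : Fin n) (ν : Fin n → ℤ) : leviColumnBall n K k ν ≤ symplecticUnipotent n K := by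
  intro g hg
  obtain ⟨c, -, rfl⟩ := mem_leviColumnBall_iff.1 hg
  exact leviColumnHom_mem_symplecticUnipotent _ _

/-- Monotonicity of `N(ν)` in the weight: `N(ν) ≤ N(ν')` if `ν ≤ ν'`. [cite: BruhatTits1972, §6.1] -/
theorem siegelLowerBall_mono {ν ν' : Fin n → ℤ} (h : ∀ a, ν a ≤ ν' a) : siegelLowerBall n K ν ≤ siegelLowerBall n K ν' := by
  intro g hg
  obtain ⟨c, hc, rfl⟩ := mem_siegelLowerBall_iff.1 hg
  exact siegelLowerHom_mem_siegelLowerBall fun a b hab =>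
    (hc a b hab).trans (WithZero.exp_le_exp.2 (add_le_add (h a) (h b)))

/-- Monotonicity of `X_k(ν)`: `X_k(ν) ≤ X_k(ν')` if `ν_a - ν_k ≤ ν'_a - ν'_k` for `a < k`. [cite: BruhatTits1972, §6.1] -/
theorem leviColumnBall_mono {k : Fin n} {ν ν' : Fin n → ℤ} (h : ∀ a, a < k → ν a - ν k ≤ ν' a - ν' k) :
    leviColumnBall n K k ν ≤ leviColumnBall n K k ν' := by
  intro g hg
  obtain ⟨c, hc, rfl⟩ := mem_leviColumnBall_iff.1 hg
  exact leviColumnHom_mem_leviColumnBall fun a ha => (hc a ha).trans (WithZero.exp_le_exp.2 (h a ha))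

/-- **`N(0) ≤ Sp_{2n}(𝒪)`** and more generally `N(ν) ≤ B(𝒪)` whenever `ν ≤ 0`. [cite: AndrianovZhuravlev1995, Ch. 3 §3 Lemma 3.4] -/
theorem siegelLowerBall_le_borelInt {ν : Fin n → ℤ} (hν : ∀ a, ν a ≤ 0) :
    siegelLowerBall n K ν ≤ symplecticBorel n K ⊓ symplecticInt (Fin n) K := by
  intro g hg
  obtain ⟨c, hc, rfl⟩ := mem_siegelLowerBall_iff.1 hg
  refine Subgroup.mem_inf.2 ⟨(siegelLowerHom_mem_symplecticUnipotent _).1, siegelLowerHom_mem_symplecticInt_iff.2 fun a b hab => ?_⟩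
  rw [toAdd_ofAdd]
  refine (hc a b hab).trans ?_
  rw [← WithZero.exp_zero, WithZero.exp_le_exp]
  have := hν a; have := hν b; omega

/-- **`X_k(0) ≤ Sp_{2n}(𝒪)`**, and `X_k(ν) ≤ B(𝒪)` whenever `ν_a ≤ ν_k` for `a < k` (`ν` monotone). [cite: AndrianovZhuravlev1995, Ch. 3 §3 Lemma 3.4] -/
theorem leviColumnBall_le_borelInt {k : Fin n} {ν : Fin n → ℤ} (hν : ∀ a, a < k → ν a ≤ ν k) :
    leviColumnBall n K k ν ≤ symplecticBorel n K ⊓ symplecticInt (Fin n) K := by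
  intro g hg
  obtain ⟨c, hc, rfl⟩ := mem_leviColumnBall_iff.1 hg
  refine Subgroup.mem_inf.2 ⟨(leviColumnHom_mem_symplecticUnipotent _ _).1, leviColumnHom_mem_symplecticInt_iff.2 fun a ha => ?_⟩
  rw [toAdd_ofAdd]
  refine (hc a ha).trans ?_
  rw [← WithZero.exp_zero, WithZero.exp_le_exp]
  have := hν a ha; omega

/-- **`t_μ N(ν) t_μ⁻¹ = N(ν + μ)`**: conjugation by `t_μ` shifts the weight. [cite: BruhatTits1972, (4.4.3), §6.1]
[cite: Macdonald1995, Ch. V (2.6)] -/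
theorem conjAct_smul_siegelLowerBall (hϖ : Valued.v ϖ = WithZero.exp (-1 : ℤ)) {t : symplecticGroup (Fin n) K} {μ : Fin n → ℤ}
    (ht : (t : Matrix (Fin n ⊕ Fin n) (Fin n ⊕ Fin n) K) = Matrix.diagonal fun s => ϖ ^ Sum.elim μ (-μ) s) (ν : Fin n → ℤ) :
    toConjAct t • siegelLowerBall n K ν = siegelLowerBall n K (ν + μ) := by
  have hϖ0 := uniformizer_ne_zero hϖ
  ext g
  rw [Subgroup.mem_smul_pointwise_iff_exists]
  constructor
  · rintro ⟨s, hs, rfl⟩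
    obtain ⟨c, hc, rfl⟩ := mem_siegelLowerBall_iff.1 hs
    rw [toConjAct_smul, conj_siegelLowerHom hϖ0 ht]
    refine siegelLowerHom_mem_siegelLowerBall fun a b hab => ?_
    show Valued.v (ϖ ^ (-μ a - μ b) * c (a, b)) ≤ _
    rw [map_mul, v_uniformizer_zpow hϖ, Pi.add_apply, Pi.add_apply,
      show ν a + μ a + (ν b + μ b) = -(-μ a - μ b) + (ν a + ν b) by ring, WithZero.exp_add]
    exact mul_le_mul_right (hc a b hab) _
  · intro hg
    obtain ⟨c, hc, rfl⟩ := mem_siegelLowerBall_iff.1 hg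
    refine ⟨siegelLowerHom n K (Multiplicative.ofAdd fun p => ϖ ^ (μ p.1 + μ p.2) * c p),
      siegelLowerHom_mem_siegelLowerBall fun a b hab => ?_, ?_⟩
    · show Valued.v (ϖ ^ (μ a + μ b) * c (a, b)) ≤ _
      rw [map_mul, v_uniformizer_zpow hϖ]
      have h := hc a b hab
      rw [Pi.add_apply, Pi.add_apply] at h
      have h' := mul_le_mul_right h (WithZero.exp (-(μ a + μ b)))
      rwa [← WithZero.exp_add, show -(μ a + μ b) + (ν a + μ a + (ν b + μ b)) = ν a + ν b by ring] at h'
    · rw [toConjAct_smul, conj_siegelLowerHom hϖ0 ht]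
      congr 1
      refine congrArg Multiplicative.ofAdd (funext fun p => ?_)
      rw [toAdd_ofAdd, ← mul_assoc, ← zpow_add₀ hϖ0, show -μ p.1 - μ p.2 + (μ p.1 + μ p.2) = 0 by ring, zpow_zero, one_mul]

/-- **`t_μ X_k(ν) t_μ⁻¹ = X_k(ν + μ)`**. [cite: BruhatTits1972, (4.4.3), §6.1] [cite: Macdonald1995, Ch. V (2.6)] -/
theorem conjAct_smul_leviColumnBall (hϖ : Valued.v ϖ = WithZero.exp (-1 : ℤ)) {t : symplecticGroup (Fin n) K} {μ : Fin n → ℤ}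
    (ht : (t : Matrix (Fin n ⊕ Fin n) (Fin n ⊕ Fin n) K) = Matrix.diagonal fun s => ϖ ^ Sum.elim μ (-μ) s) (k : Fin n)
    (ν : Fin n → ℤ) : toConjAct t • leviColumnBall n K k ν = leviColumnBall n K k (ν + μ) := by
  have hϖ0 := uniformizer_ne_zero hϖ
  ext g
  rw [Subgroup.mem_smul_pointwise_iff_exists]
  constructor
  · rintro ⟨s, hs, rfl⟩
    obtain ⟨c, hc, rfl⟩ := mem_leviColumnBall_iff.1 hs
    rw [toConjAct_smul, conj_leviColumnHom hϖ0 ht]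
    refine leviColumnHom_mem_leviColumnBall fun a ha => ?_
    show Valued.v (ϖ ^ (μ k - μ a) * c a) ≤ _
    rw [map_mul, v_uniformizer_zpow hϖ, Pi.add_apply, Pi.add_apply,
      show ν a + μ a - (ν k + μ k) = -(μ k - μ a) + (ν a - ν k) by ring, WithZero.exp_add]
    exact mul_le_mul_right (hc a ha) _
  · intro hg
    obtain ⟨c, hc, rfl⟩ := mem_leviColumnBall_iff.1 hg
    refine ⟨leviColumnHom k (Multiplicative.ofAdd fun a => ϖ ^ (μ a - μ k) * c a),
      leviColumnHom_mem_leviColumnBall fun a ha => ?_, ?_⟩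
    · show Valued.v (ϖ ^ (μ a - μ k) * c a) ≤ _
      rw [map_mul, v_uniformizer_zpow hϖ]
      have h := hc a ha
      rw [Pi.add_apply, Pi.add_apply] at h
      have h' := mul_le_mul_right h (WithZero.exp (-(μ a - μ k)))
      rwa [← WithZero.exp_add, show -(μ a - μ k) + (ν a + μ a - (ν k + μ k)) = ν a - ν k by ring] at h'
    · rw [toConjAct_smul, conj_leviColumnHom hϖ0 ht]
      congr 1
      refine congrArg Multiplicative.ofAdd (funext fun a => ?_)
      rw [toAdd_ofAdd, ← mul_assoc, ← zpow_add₀ hϖ0, show μ k - μ a + (μ a - μ k) = 0 by ring, zpow_zero, one_mul]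

end Valued
/-! ## §6 Normalisation: Chevalley commutator relations among the root groups -/

/-- A subgroup `L` all of whose elements conjugate `H` into itself normalises `H` (apply the hypothesis to `g` and `g⁻¹`).
[folklore] -/
private theorem le_normalizer_of_conj_le {G : Type*} [Group G] {L H : Subgroup G} (h : ∀ g ∈ L, toConjAct g • H ≤ H) :
    L ≤ Subgroup.normalizer (H : Set G) := by
  intro g hg
  rw [Subgroup.mem_normalizer_iff]
  intro x
  constructor
  · intro hx
    have hx' : toConjAct g • x ∈ toConjAct g • H := Subgroup.smul_mem_pointwise_smul _ _ _ hx
    rw [toConjAct_smul] at hx'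
    exact h g hg hx'
  · intro hx
    have hx' : toConjAct g⁻¹ • (g * x * g⁻¹) ∈ toConjAct g⁻¹ • H := Subgroup.smul_mem_pointwise_smul _ _ _ hx
    rw [toConjAct_smul, inv_inv, show g⁻¹ * (g * x * g⁻¹) * g = x by group] at hx'
    exact h g⁻¹ (L.inv_mem hg) hx'

/-- **Commutator relation between Levi columns**: for `j < k`,
`m(1 + N_j(c')) · m(1 + N_k(c)) = m(1 + N_k(c'')) · m(1 + N_j(c'))` with `c''_a = c_a + [a < j] c'_a c_j`
(`[x_{ε_a-ε_j}(s), x_{ε_j-ε_k}(t)] = x_{ε_a-ε_k}(st)`). [cite: Macdonald1995, Ch. V (2.6)] [cite: BruhatTits1972, §6.1] -/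
theorem leviColumnHom_mul_leviColumnHom_of_lt {j k : Fin n} (hjk : j < k) (c' c : Multiplicative (Fin n → K)) :
    leviColumnHom j c' * leviColumnHom k c =
      leviColumnHom k (Multiplicative.ofAdd fun a => Multiplicative.toAdd c a +
          if a < j then Multiplicative.toAdd c' a * Multiplicative.toAdd c j else 0) * leviColumnHom j c' := by
  refine Subtype.ext ?_
  simp only [Submonoid.coe_mul, coe_leviColumnHom, Matrix.fromBlocks_multiply, toAdd_ofAdd]
  set N := leviColumnNil k (Multiplicative.toAdd c) with hN
  set N' := leviColumnNil j (Multiplicative.toAdd c') with hN'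
  set P := leviColumnNil k (fun a => if a < j then Multiplicative.toAdd c' a * Multiplicative.toAdd c j else 0) with hP_def
  have hsum : leviColumnNil k (fun a => Multiplicative.toAdd c a +
      if a < j then Multiplicative.toAdd c' a * Multiplicative.toAdd c j else 0) = N + P := by
    rw [hN, hP_def, ← leviColumnNil_add]; rfl
  have hP : N' * N = P := leviColumnNil_mul_leviColumnNil_of_lt hjk _ _
  have hNN' : N * N' = 0 := leviColumnNil_mul_leviColumnNil_of_le hjk.le _ _
  have hN'N' : N' * N' = 0 := leviColumnNil_mul_leviColumnNil_of_le le_rfl _ _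
  have hPN' : P * N' = 0 := leviColumnNil_mul_leviColumnNil_of_le hjk.le _ _
  have hN'P : N' * P = 0 := by rw [← hP, ← mul_assoc, hN'N', zero_mul]
  have hA1 : N'ᵀ * Nᵀ = 0 := by rw [← Matrix.transpose_mul, hNN', Matrix.transpose_zero]
  have hA2 : Nᵀ * N'ᵀ = Pᵀ := by rw [← Matrix.transpose_mul, hP]
  have hA3 : Pᵀ * N'ᵀ = 0 := by rw [← Matrix.transpose_mul, hN'P, Matrix.transpose_zero]
  rw [hsum]
  congr 1
  · simp only [Matrix.transpose_add, sub_mul, mul_sub, add_mul, one_mul, mul_one, hA1, hA2, hA3, Matrix.zero_mul,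
      add_zero, sub_zero]
    abel
  · simp
  · simp
  · simp only [add_mul, mul_add, one_mul, mul_one, hP, hNN', hPN', Matrix.zero_mul, add_zero]
    abel

/-- Valuations of the entries of `1 + N_k(c)` for `m(1 + N_k(c)) ∈ X_k(ν)`: `v((1 + N_k(c))_{al}) ≤ exp(ν_a - ν_l)`.
[cite: Macdonald1995, Ch. V (2.6)] -/
theorem v_one_add_leviColumnNil_apply_le [Valued K ℤᵐ⁰] {k : Fin n} {ν : Fin n → ℤ} {c : Fin n → K}
    (hc : ∀ a : Fin n, a < k → Valued.v (c a) ≤ WithZero.exp (ν a - ν k)) (a l : Fin n) :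
    Valued.v ((1 + leviColumnNil k c) a l) ≤ WithZero.exp (ν a - ν l) := by
  rw [Matrix.add_apply, leviColumnNil_apply]
  by_cases h : l = k ∧ a < k
  · obtain ⟨rfl, ha⟩ := h
    rw [if_pos ⟨rfl, ha⟩, Matrix.one_apply_ne (ne_of_lt ha), zero_add]
    exact hc a ha
  · rw [if_neg h, add_zero]
    by_cases hal : a = l
    · rw [hal, Matrix.one_apply_eq, map_one, sub_self, WithZero.exp_zero]
    · rw [Matrix.one_apply_ne hal, map_zero]; exact zero_le

/-- **The ultrametric product bound**: if `v(X_{al}) ≤ exp(f_a - g_l)` and `v(Y_{lb}) ≤ exp(g_l + h_b)` then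
`v((XY)_{ab}) ≤ exp(f_a + h_b)`. [cite: Serre1979, Ch. I §1] -/
theorem v_mul_apply_le_exp [Valued K ℤᵐ⁰] {X Y : Matrix (Fin n) (Fin n) K} {f g h : Fin n → ℤ}
    (hX : ∀ a l, Valued.v (X a l) ≤ WithZero.exp (f a - g l)) (hY : ∀ l b, Valued.v (Y l b) ≤ WithZero.exp (g l + h b))
    (a b : Fin n) : Valued.v ((X * Y) a b) ≤ WithZero.exp (f a + h b) := by
  rw [Matrix.mul_apply]
  refine Valued.v.map_sum_le fun l _ => ?_
  rw [map_mul, show f a + h b = (f a - g l) + (g l + h b) by ring, WithZero.exp_add]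
  exact mul_le_mul' (hX a l) (hY l b)

/-- **`X_j(ν)` normalises `X_k(ν)` for `j < k`** (the radii add up: `(ν_a - ν_j) + (ν_j - ν_k) = ν_a - ν_k`).
[cite: BruhatTits1972, §6.1] [cite: Macdonald1995, Ch. V (2.6)] -/
theorem leviColumnBall_le_normalizer_leviColumnBall [Valued K ℤᵐ⁰] {j k : Fin n} (hjk : j < k) (ν : Fin n → ℤ) :
    leviColumnBall n K j ν ≤ Subgroup.normalizer (leviColumnBall n K k ν : Set (symplecticGroup (Fin n) K)) := by
  refine le_normalizer_of_conj_le fun g hg => ?_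
  obtain ⟨c', hc', rfl⟩ := mem_leviColumnBall_iff.1 hg
  intro y hy
  rw [Subgroup.mem_smul_pointwise_iff_exists] at hy
  obtain ⟨x, hx, rfl⟩ := hy
  obtain ⟨c, hc, rfl⟩ := mem_leviColumnBall_iff.1 hx
  rw [toConjAct_smul, leviColumnHom_mul_leviColumnHom_of_lt hjk, mul_inv_cancel_right]
  refine leviColumnHom_mem_leviColumnBall fun a ha => ?_
  show Valued.v (c a + if a < j then c' a * c j else 0) ≤ _
  refine Valuation.map_add_le _ (hc a ha) ?_
  split_ifs with haj
  · rw [map_mul, show ν a - ν k = (ν a - ν j) + (ν j - ν k) by ring, WithZero.exp_add]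
    exact mul_le_mul' (hc' a haj) (hc j hjk)
  · rw [map_zero]; exact zero_le

omit [Field K] in
/-- A symmetric matrix is the symmetric matrix of its upper-triangle entries. [folklore] -/
private theorem of_ite_le_eq_of_isSymm [Field K] {M : Matrix (Fin n) (Fin n) K} (hM : M.IsSymm) :
    (Matrix.of fun a b => if a ≤ b then M a b else M b a) = M := by
  ext a b
  rw [Matrix.of_apply]
  split_ifs with hab
  · rfl
  · exact hM.apply a b

/-- **Levi elements conjugate the Siegel radical through `C ↦ D C ᵗD`**: for `g = (A 0; 0 D) ∈ Sp` (so `AᵗD = 1`) and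
`C = S(c)` symmetric, `g · u(C) = u(D C ᵗD) · g`. [cite: AndrianovZhuravlev1995, Ch. 1 §3 Prop. 3.7] [cite: Macdonald1995, Ch. V (2.6)] -/
theorem mul_siegelLowerHom_of_blocks_eq_zero {g : symplecticGroup (Fin n) K}
    (hB : ∀ i j, (g : Matrix (Fin n ⊕ Fin n) (Fin n ⊕ Fin n) K) (Sum.inl i) (Sum.inr j) = 0)
    (hC : ∀ i j, (g : Matrix (Fin n ⊕ Fin n) (Fin n ⊕ Fin n) K) (Sum.inr i) (Sum.inl j) = 0) (c : Fin n × Fin n → K) :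
    g * siegelLowerHom n K (Multiplicative.ofAdd c) =
      siegelLowerHom n K (Multiplicative.ofAdd fun p =>
        ((g : Matrix (Fin n ⊕ Fin n) (Fin n ⊕ Fin n) K).toBlocks₂₂ *
          (Matrix.of fun a b => if a ≤ b then c (a, b) else c (b, a)) *
            ((g : Matrix (Fin n ⊕ Fin n) (Fin n ⊕ Fin n) K).toBlocks₂₂)ᵀ) p.1 p.2) * g := by
  -- blocks of `g`
  set A := (g : Matrix (Fin n ⊕ Fin n) (Fin n ⊕ Fin n) K).toBlocks₁₁ with hA
  set D := (g : Matrix (Fin n ⊕ Fin n) (Fin n ⊕ Fin n) K).toBlocks₂₂ with hD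
  set S := (Matrix.of fun a b => if a ≤ b then c (a, b) else c (b, a) : Matrix (Fin n) (Fin n) K) with hS
  have hB0 : (g : Matrix (Fin n ⊕ Fin n) (Fin n ⊕ Fin n) K).toBlocks₁₂ = 0 := by ext i j; exact hB i j
  have hC0 : (g : Matrix (Fin n ⊕ Fin n) (Fin n ⊕ Fin n) K).toBlocks₂₁ = 0 := by ext i j; exact hC i j
  have hg : (g : Matrix (Fin n ⊕ Fin n) (Fin n ⊕ Fin n) K) = Matrix.fromBlocks A 0 0 D := by
    rw [eq_fromBlocks_toBlocks (g : Matrix (Fin n ⊕ Fin n) (Fin n ⊕ Fin n) K), hB0, hC0]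
  -- `AᵗD = 1`, `ᵗD A = 1`
  have hAD : A * Dᵀ = 1 := by
    have h := (toBlocks_mul_transpose_of_mem_symplecticGroup g.2).1
    rwa [hB0, Matrix.zero_mul, sub_zero] at h
  have hDA : Dᵀ * A = 1 := mul_eq_one_comm.1 hAD
  -- `S` and `D S ᵗD` are symmetric
  have hSsymm : S.IsSymm := by
    refine Matrix.IsSymm.ext fun a b => ?_
    simp only [hS, Matrix.of_apply]
    by_cases hab : a ≤ b
    · by_cases hba : b ≤ a
      · rw [le_antisymm hab hba]
      · rw [if_pos hab, if_neg hba]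
    · rw [if_neg hab, if_pos (le_of_not_ge hab)]
  have hDSD : (D * S * Dᵀ).IsSymm := by
    rw [Matrix.IsSymm, Matrix.transpose_mul, Matrix.transpose_mul, Matrix.transpose_transpose, hSsymm.eq, Matrix.mul_assoc]
  refine Subtype.ext ?_
  rw [Submonoid.coe_mul, Submonoid.coe_mul, coe_siegelLowerHom, coe_siegelLowerHom, toAdd_ofAdd, toAdd_ofAdd, hg,
    of_ite_le_eq_of_isSymm hDSD, Matrix.fromBlocks_multiply, Matrix.fromBlocks_multiply]
  simp only [Matrix.mul_one, Matrix.one_mul, Matrix.mul_zero, Matrix.zero_mul, add_zero, zero_add]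
  rw [Matrix.mul_assoc (D * S), hDA, Matrix.mul_one]

/-- **The Levi columns normalise `N(ν)`**: `X_k(ν) ≤ N_G(N(ν))` (`v((D C ᵗD)_{ab}) ≤ exp(ν_a + ν_b)` by the ultrametric
inequality). [cite: BruhatTits1972, §6.1] [cite: Macdonald1995, Ch. V (2.6)] -/
theorem leviColumnBall_le_normalizer_siegelLowerBall [Valued K ℤᵐ⁰] (k : Fin n) (ν : Fin n → ℤ) :
    leviColumnBall n K k ν ≤ Subgroup.normalizer (siegelLowerBall n K ν : Set (symplecticGroup (Fin n) K)) := by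
  refine le_normalizer_of_conj_le fun g hg => ?_
  obtain ⟨c', hc', rfl⟩ := mem_leviColumnBall_iff.1 hg
  intro y hy
  rw [Subgroup.mem_smul_pointwise_iff_exists] at hy
  obtain ⟨x, hx, rfl⟩ := hy
  obtain ⟨c, hc, rfl⟩ := mem_siegelLowerBall_iff.1 hx
  rw [toConjAct_smul, mul_siegelLowerHom_of_blocks_eq_zero (fun i j => (leviColumnHom_apply_inr_inl k _ i j).2)
    (fun i j => (leviColumnHom_apply_inr_inl k _ i j).1), mul_inv_cancel_right]
  refine siegelLowerHom_mem_siegelLowerBall fun a b _ => ?_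
  have hD : ((leviColumnHom k (Multiplicative.ofAdd c') : symplecticGroup (Fin n) K) :
      Matrix (Fin n ⊕ Fin n) (Fin n ⊕ Fin n) K).toBlocks₂₂ = 1 + leviColumnNil k c' := by
    ext i j
    rw [Matrix.toBlocks₂₂, Matrix.of_apply, coe_leviColumnHom, Matrix.fromBlocks_apply₂₂, toAdd_ofAdd]
  dsimp only
  rw [hD]
  have hS : ∀ l m : Fin n, Valued.v ((Matrix.of fun a b => if a ≤ b then c (a, b) else c (b, a) : Matrix (Fin n) (Fin n) K) l m) ≤
      WithZero.exp (ν l + ν m) := by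
    intro l m
    rw [Matrix.of_apply]
    split_ifs with hlm
    · exact hc l m hlm
    · rw [add_comm]; exact hc m l (le_of_not_ge hlm)
  have h1 : ∀ a m : Fin n, Valued.v (((1 + leviColumnNil k c') *
      (Matrix.of fun a b => if a ≤ b then c (a, b) else c (b, a) : Matrix (Fin n) (Fin n) K)) a m) ≤ WithZero.exp (ν a - (-ν) m) := by
    intro a m
    rw [Pi.neg_apply, sub_neg_eq_add]
    exact v_mul_apply_le_exp (f := ν) (g := ν) (h := ν) (v_one_add_leviColumnNil_apply_le hc') hS a m
  refine v_mul_apply_le_exp (f := ν) (g := -ν) (h := ν) h1 (fun m b => ?_) a b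
  rw [Matrix.transpose_apply, Pi.neg_apply, show -ν m + ν b = ν b - ν m by ring]
  exact v_one_add_leviColumnNil_apply_le hc' b m

/-- `⨆_{j<k} X_j(ν)` normalises `X_k(ν)`. [cite: BruhatTits1972, §6.1] -/
theorem iSup_leviColumnBall_le_normalizer_leviColumnBall [Valued K ℤᵐ⁰] (k : Fin n) (ν : Fin n → ℤ) :
    (⨆ (j : Fin n) (_ : (j : ℕ) < (k : ℕ)), leviColumnBall n K j ν) ≤
      Subgroup.normalizer (leviColumnBall n K k ν : Set (symplecticGroup (Fin n) K)) :=
  iSup_le fun _ => iSup_le fun hjk => leviColumnBall_le_normalizer_leviColumnBall (Fin.lt_def.2 hjk) ν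

/-- `⨆_j X_j(ν)` normalises `N(ν)`. [cite: BruhatTits1972, §6.1] -/
theorem iSup_leviColumnBall_le_normalizer_siegelLowerBall [Valued K ℤᵐ⁰] (ν : Fin n → ℤ) :
    (⨆ j : Fin n, leviColumnBall n K j ν) ≤ Subgroup.normalizer (siegelLowerBall n K ν : Set (symplecticGroup (Fin n) K)) :=
  iSup_le fun j => leviColumnBall_le_normalizer_siegelLowerBall j ν

/-! ## §7 Disjointness: Levi products have `C = 0` and their unused columns are trivial -/

/-- Elements of `⨆_{j<k} X_j(ν)` have vanishing `(inr, inl)`-block and trivial `D`-columns `b ≥ k`.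
[cite: Macdonald1995, Ch. V (2.6)] [cite: BruhatTits1972, §6.1] -/
theorem apply_of_mem_iSup_leviColumnBall [Valued K ℤᵐ⁰] {k : ℕ} {ν : Fin n → ℤ} {g : symplecticGroup (Fin n) K}
    (hg : g ∈ ⨆ (j : Fin n) (_ : (j : ℕ) < k), leviColumnBall n K j ν) :
    (∀ a b : Fin n, (g : Matrix (Fin n ⊕ Fin n) (Fin n ⊕ Fin n) K) (Sum.inr a) (Sum.inl b) = 0) ∧
      ∀ a b : Fin n, k ≤ (b : ℕ) → (g : Matrix (Fin n ⊕ Fin n) (Fin n ⊕ Fin n) K) (Sum.inr a) (Sum.inr b) =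
        (1 : Matrix (Fin n) (Fin n) K) a b := by
  refine Subgroup.iSup_induction (fun j : Fin n => ⨆ (_ : (j : ℕ) < k), leviColumnBall n K j ν)
    (C := fun g : symplecticGroup (Fin n) K =>
      (∀ a b : Fin n, (g : Matrix (Fin n ⊕ Fin n) (Fin n ⊕ Fin n) K) (Sum.inr a) (Sum.inl b) = 0) ∧
        ∀ a b : Fin n, k ≤ (b : ℕ) → (g : Matrix (Fin n ⊕ Fin n) (Fin n ⊕ Fin n) K) (Sum.inr a) (Sum.inr b) =
          (1 : Matrix (Fin n) (Fin n) K) a b) hg ?_ ?_ ?_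
  · intro j x hx
    by_cases hjk : (j : ℕ) < k
    · rw [iSup_pos hjk] at hx
      obtain ⟨c, -, rfl⟩ := mem_leviColumnBall_iff.1 hx
      refine ⟨fun a b => (leviColumnHom_apply_inr_inl j _ a b).1, fun a b hb => ?_⟩
      rw [leviColumnHom_apply_inr_inr, if_neg, add_zero]
      rintro ⟨rfl, -⟩
      exact absurd hjk (not_lt.2 hb)
    · rw [iSup_neg hjk, Subgroup.mem_bot] at hx
      subst hx
      refine ⟨fun a b => ?_, fun a b _ => ?_⟩
      · exact Matrix.one_apply_ne Sum.inr_ne_inl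
      · change (1 : Matrix (Fin n ⊕ Fin n) (Fin n ⊕ Fin n) K) (Sum.inr a) (Sum.inr b) = _
        by_cases hab : a = b
        · rw [hab, Matrix.one_apply_eq, Matrix.one_apply_eq]
        · rw [Matrix.one_apply_ne hab, Matrix.one_apply_ne (fun h => hab (Sum.inr_injective h))]
  · refine ⟨fun a b => ?_, fun a b _ => ?_⟩
    · exact Matrix.one_apply_ne Sum.inr_ne_inl
    · change (1 : Matrix (Fin n ⊕ Fin n) (Fin n ⊕ Fin n) K) (Sum.inr a) (Sum.inr b) = _
      by_cases hab : a = b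
      · rw [hab, Matrix.one_apply_eq, Matrix.one_apply_eq]
      · rw [Matrix.one_apply_ne hab, Matrix.one_apply_ne (fun h => hab (Sum.inr_injective h))]
  · rintro x y ⟨hxC, hxD⟩ ⟨hyC, hyD⟩
    refine ⟨fun a b => ?_, fun a b hb => ?_⟩
    · rw [Submonoid.coe_mul, Matrix.mul_apply, Fintype.sum_sum_type]
      simp only [hyC, mul_zero, Finset.sum_const_zero, add_zero]
      exact Finset.sum_eq_zero fun l _ => by rw [hxC, zero_mul]
    · rw [Submonoid.coe_mul, Matrix.mul_apply, Fintype.sum_sum_type]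
      simp only [hxC, zero_mul, Finset.sum_const_zero, zero_add]
      simp only [hyD _ b hb]
      rw [Finset.sum_eq_single b]
      · rw [Matrix.one_apply_eq, mul_one]; exact hxD a b hb
      · intro l _ hlb; rw [Matrix.one_apply_ne hlb, mul_zero]
      · intro h; exact absurd (Finset.mem_univ b) h

/-- `m(1 + N_k(c)) = 1` when `c_a = 0` for all `a < k`. [cite: Macdonald1995, Ch. V (2.6)] -/
theorem leviColumnHom_eq_one_of_forall {k : Fin n} {c : Multiplicative (Fin n → K)}
    (h : ∀ a : Fin n, a < k → Multiplicative.toAdd c a = 0) : leviColumnHom k c = 1 := by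
  have hN : leviColumnNil k (Multiplicative.toAdd c) = 0 := by
    ext a b
    rw [leviColumnNil_apply, Matrix.zero_apply]
    split_ifs with hab
    · exact h a hab.2
    · rfl
  refine Subtype.ext ?_
  rw [coe_leviColumnHom, hN, Matrix.transpose_zero, sub_zero, add_zero, Matrix.fromBlocks_one]
  rfl

/-- `u(S(c)) = 1` when `c(a, b) = 0` for all `a ≤ b`. [cite: AndrianovZhuravlev1995, Ch. 1 §3 Prop. 3.7] -/
theorem siegelLowerHom_eq_one_of_forall {c : Multiplicative (Fin n × Fin n → K)}
    (h : ∀ a b : Fin n, a ≤ b → Multiplicative.toAdd c (a, b) = 0) : siegelLowerHom n K c = 1 := by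
  refine Subtype.ext ?_
  rw [coe_siegelLowerHom]
  have hS : (Matrix.of fun a b => if a ≤ b then Multiplicative.toAdd c (a, b) else Multiplicative.toAdd c (b, a) :
      Matrix (Fin n) (Fin n) K) = 0 := by
    ext a b
    rw [Matrix.of_apply, Matrix.zero_apply]
    split_ifs with hab
    · exact h a b hab
    · exact h b a (le_of_not_ge hab)
  rw [hS, Matrix.fromBlocks_one]
  rfl

/-- **`(⨆_{j<k} X_j(ν)) ∩ X_k(ν') = 1`** (an element of `X_k` with trivial column `k` is `1`).
[cite: BruhatTits1972, §6.1] [cite: Macdonald1995, Ch. V (2.6)] -/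
theorem iSup_leviColumnBall_inf_leviColumnBall_eq_bot [Valued K ℤᵐ⁰] (k : Fin n) (ν ν' : Fin n → ℤ) :
    (⨆ (j : Fin n) (_ : (j : ℕ) < k), leviColumnBall n K j ν) ⊓ leviColumnBall n K k ν' = ⊥ := by
  rw [eq_bot_iff]
  intro g hg
  obtain ⟨hg₁, hg₂⟩ := Subgroup.mem_inf.1 hg
  obtain ⟨c, -, rfl⟩ := mem_leviColumnBall_iff.1 hg₂
  rw [Subgroup.mem_bot]
  refine leviColumnHom_eq_one_of_forall fun a ha => ?_
  have h := (apply_of_mem_iSup_leviColumnBall hg₁).2 a k le_rfl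
  rwa [leviColumnHom_apply_inr_inr_of_lt k _ ha, Matrix.one_apply_ne (ne_of_lt ha)] at h

/-- **`(⨆_j X_j(ν)) ∩ N(ν') = 1`** (a Siegel element with `C = 0` is `1`). [cite: BruhatTits1972, §6.1]
[cite: AndrianovZhuravlev1995, Ch. 1 §3 Prop. 3.7] -/
theorem iSup_leviColumnBall_inf_siegelLowerBall_eq_bot [Valued K ℤᵐ⁰] (ν ν' : Fin n → ℤ) :
    (⨆ j : Fin n, leviColumnBall n K j ν) ⊓ siegelLowerBall n K ν' = ⊥ := by
  rw [eq_bot_iff]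
  intro g hg
  obtain ⟨hg₁, hg₂⟩ := Subgroup.mem_inf.1 hg
  obtain ⟨c, -, rfl⟩ := mem_siegelLowerBall_iff.1 hg₂
  rw [Subgroup.mem_bot]
  have hg₁' : siegelLowerHom n K (Multiplicative.ofAdd c) ∈ ⨆ (j : Fin n) (_ : (j : ℕ) < n), leviColumnBall n K j ν := by
    simp only [Fin.is_lt, iSup_pos]
    exact hg₁
  refine siegelLowerHom_eq_one_of_forall fun a b hab => ?_
  have h := (apply_of_mem_iSup_leviColumnBall hg₁').1 a b
  rwa [siegelLowerHom_apply_inr_inl hab] at h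

/-! ## §8 Generation: `U(K) ∩ Sp_{2n}(𝒪) = N(0) ⊔ ⨆_k X_k(0)` -/

section Generation

variable [Valued K ℤᵐ⁰]

/-- **Peeling the Siegel part**: an integral unipotent `g = (A 0; C D)` has `S = CᵗD` symmetric and integral, and
`u(S)⁻¹ g = (A 0; 0 D)` (`CᵗD A = C` because `ᵗD A = 1`). [cite: AndrianovZhuravlev1995, Ch. 1 §3 Prop. 3.7]
[cite: Macdonald1995, Ch. V (2.6)] -/
theorem exists_siegelLowerHom_inv_mul_apply_eq_zero {g : symplecticGroup (Fin n) K}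
    (hg : g ∈ symplecticUnipotent n K ⊓ symplecticInt (Fin n) K) :
    ∃ c : Fin n × Fin n → K, (∀ a b : Fin n, a ≤ b → Valued.v (c (a, b)) ≤ 1) ∧
      ∀ a b : Fin n, (((siegelLowerHom n K (Multiplicative.ofAdd c))⁻¹ * g : symplecticGroup (Fin n) K) :
        Matrix (Fin n ⊕ Fin n) (Fin n ⊕ Fin n) K) (Sum.inr a) (Sum.inl b) = 0 := by
  obtain ⟨hgU, hgK⟩ := Subgroup.mem_inf.1 hg
  have hgB := hgU.1
  set M := (g : Matrix (Fin n ⊕ Fin n) (Fin n ⊕ Fin n) K) with hM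
  have hB0 : M.toBlocks₁₂ = 0 := by
    ext i j; exact ((blockTriangular_symplecticBorelOrder_iff _).1 (mem_symplecticBorel_iff.1 hgB)).1 i j
  have hMb : M = Matrix.fromBlocks M.toBlocks₁₁ 0 M.toBlocks₂₁ M.toBlocks₂₂ := by
    conv_lhs => rw [eq_fromBlocks_toBlocks M, hB0]
  have hDA : (M.toBlocks₂₂)ᵀ * M.toBlocks₁₁ = 1 := (toBlocks₁₁_mul_transpose_toBlocks₂₂_of_mem_symplecticBorel hgB).2
  have hsymm : (M.toBlocks₂₁ * (M.toBlocks₂₂)ᵀ).IsSymm := by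
    have h := (toBlocks_mul_transpose_of_mem_symplecticGroup g.2).2
    rw [Matrix.IsSymm, Matrix.transpose_mul, Matrix.transpose_transpose]
    exact h
  refine ⟨fun p => (M.toBlocks₂₁ * (M.toBlocks₂₂)ᵀ) p.1 p.2, fun a b _ => ?_, fun a b => ?_⟩
  · exact v_mul_apply_le_one (fun i j => hgK (Sum.inr i) (Sum.inl j))
      (fun i j => by rw [Matrix.transpose_apply]; exact hgK (Sum.inr j) (Sum.inr i)) a b
  · have hS : (Matrix.of fun a b => if a ≤ b then (-(fun p : Fin n × Fin n => (M.toBlocks₂₁ * (M.toBlocks₂₂)ᵀ) p.1 p.2)) (a, b)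
        else (-(fun p : Fin n × Fin n => (M.toBlocks₂₁ * (M.toBlocks₂₂)ᵀ) p.1 p.2)) (b, a) : Matrix (Fin n) (Fin n) K) =
        -(M.toBlocks₂₁ * (M.toBlocks₂₂)ᵀ) := by
      ext a b
      rw [Matrix.of_apply, Matrix.neg_apply, Pi.neg_apply, Pi.neg_apply]
      split_ifs with hab
      · rfl
      · exact congrArg Neg.neg (hsymm.apply a b)
    rw [← map_inv, ← ofAdd_neg, Submonoid.coe_mul, coe_siegelLowerHom, toAdd_ofAdd, ← hM, hS]
    have e : Matrix.fromBlocks (1 : Matrix (Fin n) (Fin n) K) 0 (-(M.toBlocks₂₁ * (M.toBlocks₂₂)ᵀ)) 1 * M =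
        Matrix.fromBlocks (1 : Matrix (Fin n) (Fin n) K) 0 (-(M.toBlocks₂₁ * (M.toBlocks₂₂)ᵀ)) 1 *
          Matrix.fromBlocks M.toBlocks₁₁ 0 M.toBlocks₂₁ M.toBlocks₂₂ := by rw [← hMb]
    rw [e, Matrix.fromBlocks_multiply, Matrix.fromBlocks_apply₂₁, Matrix.one_mul, Matrix.neg_mul, Matrix.mul_assoc, hDA,
      Matrix.mul_one, neg_add_cancel, Matrix.zero_apply]

omit [Valued K ℤᵐ⁰] in
/-- **The row of `m(1 + N_κ(c))⁻¹ g`**: `(m(1 + N_κ(c))⁻¹ g)_{inr a, s} = g_{inr a, s} - [a < κ] c_a g_{inr κ, s}` (for any `g`).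
[cite: Macdonald1995, Ch. V (2.6)] -/
theorem leviColumnHom_inv_mul_apply_inr (κ : Fin n) (c : Fin n → K) (g : symplecticGroup (Fin n) K) (a : Fin n)
    (s : Fin n ⊕ Fin n) :
    (((leviColumnHom κ (Multiplicative.ofAdd c))⁻¹ * g : symplecticGroup (Fin n) K) : Matrix (Fin n ⊕ Fin n) (Fin n ⊕ Fin n) K)
        (Sum.inr a) s =
      (g : Matrix (Fin n ⊕ Fin n) (Fin n ⊕ Fin n) K) (Sum.inr a) s -
        if a < κ then c a * (g : Matrix (Fin n ⊕ Fin n) (Fin n ⊕ Fin n) K) (Sum.inr κ) s else 0 := by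
  rw [← map_inv, ← ofAdd_neg, Submonoid.coe_mul, Matrix.mul_apply, Fintype.sum_sum_type]
  have h1 : ∑ l : Fin n, ((leviColumnHom κ (Multiplicative.ofAdd (-c)) : symplecticGroup (Fin n) K) :
      Matrix (Fin n ⊕ Fin n) (Fin n ⊕ Fin n) K) (Sum.inr a) (Sum.inl l) * (g : Matrix (Fin n ⊕ Fin n) (Fin n ⊕ Fin n) K) (Sum.inl l) s = 0 :=
    Finset.sum_eq_zero fun l _ => by rw [(leviColumnHom_apply_inr_inl κ _ a l).1, zero_mul]
  have h2 : ∑ l : Fin n, (1 : Matrix (Fin n) (Fin n) K) a l * (g : Matrix (Fin n ⊕ Fin n) (Fin n ⊕ Fin n) K) (Sum.inr l) s =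
      (g : Matrix (Fin n ⊕ Fin n) (Fin n ⊕ Fin n) K) (Sum.inr a) s := by
    rw [Finset.sum_eq_single a, Matrix.one_apply_eq, one_mul]
    · intro l _ hla; rw [Matrix.one_apply_ne (Ne.symm hla), zero_mul]
    · intro h; exact absurd (Finset.mem_univ a) h
  have h3 : ∑ l : Fin n, (if l = κ ∧ a < κ then -c a else 0) * (g : Matrix (Fin n ⊕ Fin n) (Fin n ⊕ Fin n) K) (Sum.inr l) s =
      if a < κ then -c a * (g : Matrix (Fin n ⊕ Fin n) (Fin n ⊕ Fin n) K) (Sum.inr κ) s else 0 := by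
    rw [Finset.sum_eq_single κ]
    · by_cases ha : a < κ
      · rw [if_pos ⟨rfl, ha⟩, if_pos ha]
      · rw [if_neg (fun h => ha h.2), if_neg ha, zero_mul]
    · intro l _ hl; rw [if_neg (fun h => hl h.1), zero_mul]
    · intro h; exact absurd (Finset.mem_univ κ) h
  rw [h1, zero_add]
  simp only [leviColumnHom_apply_inr_inr, toAdd_ofAdd, Pi.neg_apply, add_mul, Finset.sum_add_distrib]
  rw [h2, h3]
  split_ifs <;> ring

/-- **Peeling the Levi columns** (induction on `k`): an integral unipotent `g` with `C = 0` whose `D`-columns `b ≥ k` are trivial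
lies in `⨆_{j<k} X_j(0)` — peel `m(1 + N_{k-1}(col_{k-1} D))`, which clears column `k - 1`.
[cite: Macdonald1995, Ch. V (2.6)] [cite: BruhatTits1972, §6.1] -/
theorem mem_iSup_leviColumnBall_of_columns_trivial :
    ∀ (k : ℕ), k ≤ n → ∀ {g : symplecticGroup (Fin n) K}, g ∈ symplecticUnipotent n K ⊓ symplecticInt (Fin n) K →
      (∀ a b : Fin n, (g : Matrix (Fin n ⊕ Fin n) (Fin n ⊕ Fin n) K) (Sum.inr a) (Sum.inl b) = 0) →
      (∀ a b : Fin n, k ≤ (b : ℕ) → (g : Matrix (Fin n ⊕ Fin n) (Fin n ⊕ Fin n) K) (Sum.inr a) (Sum.inr b) =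
        (1 : Matrix (Fin n) (Fin n) K) a b) →
      g ∈ ⨆ (j : Fin n) (_ : (j : ℕ) < k), leviColumnBall n K j (0 : Fin n → ℤ) := by
  intro k
  induction k with
  | zero =>
    intro _ g hg hC hD
    -- `g = 1`
    obtain ⟨hgU, -⟩ := Subgroup.mem_inf.1 hg
    have hgB := hgU.1
    have hD1 : (g : Matrix (Fin n ⊕ Fin n) (Fin n ⊕ Fin n) K).toBlocks₂₂ = 1 := by
      ext a b; exact hD a b (Nat.zero_le _)
    have hA1 : (g : Matrix (Fin n ⊕ Fin n) (Fin n ⊕ Fin n) K).toBlocks₁₁ = 1 := by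
      have h := (toBlocks₁₁_mul_transpose_toBlocks₂₂_of_mem_symplecticBorel hgB).2
      rwa [hD1, Matrix.transpose_one, Matrix.one_mul] at h
    have hg1 : g = 1 := by
      refine Subtype.ext (Matrix.ext fun s s' => ?_)
      change (g : Matrix (Fin n ⊕ Fin n) (Fin n ⊕ Fin n) K) s s' = (1 : Matrix (Fin n ⊕ Fin n) (Fin n ⊕ Fin n) K) s s'
      rcases s with a | a <;> rcases s' with b | b
      · have h := congrFun (congrFun hA1 a) b
        rw [Matrix.toBlocks₁₁, Matrix.of_apply] at h
        rw [h]
        by_cases hab : a = b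
        · rw [hab, Matrix.one_apply_eq, Matrix.one_apply_eq]
        · rw [Matrix.one_apply_ne hab, Matrix.one_apply_ne (fun h => hab (Sum.inl_injective h))]
      · rw [((blockTriangular_symplecticBorelOrder_iff _).1 (mem_symplecticBorel_iff.1 hgB)).1 a b,
          Matrix.one_apply_ne Sum.inl_ne_inr]
      · rw [hC a b, Matrix.one_apply_ne Sum.inr_ne_inl]
      · rw [hD a b (Nat.zero_le _)]
        by_cases hab : a = b
        · rw [hab, Matrix.one_apply_eq, Matrix.one_apply_eq]
        · rw [Matrix.one_apply_ne hab, Matrix.one_apply_ne (fun h => hab (Sum.inr_injective h))]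
    rw [hg1]
    exact Subgroup.one_mem _
  | succ k ih =>
    intro hk g hg hC hD
    have hkn : k < n := Nat.lt_of_succ_le hk
    set κ : Fin n := ⟨k, hkn⟩ with hκ
    obtain ⟨hgU, hgK⟩ := Subgroup.mem_inf.1 hg
    have hgB := hgU.1
    -- the column `κ` of `D`
    set c : Fin n → K := fun a => (g : Matrix (Fin n ⊕ Fin n) (Fin n ⊕ Fin n) K) (Sum.inr a) (Sum.inr κ) with hc
    set x : symplecticGroup (Fin n) K := leviColumnHom κ (Multiplicative.ofAdd c) with hx
    have hxX : x ∈ leviColumnBall n K κ (0 : Fin n → ℤ) := by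
      refine leviColumnHom_mem_leviColumnBall fun a _ => ?_
      rw [Pi.zero_apply, Pi.zero_apply, sub_zero, WithZero.exp_zero]
      exact hgK _ _
    have hxU : x ∈ symplecticUnipotent n K ⊓ symplecticInt (Fin n) K := by
      refine Subgroup.mem_inf.2 ⟨leviColumnHom_mem_symplecticUnipotent _ _, leviColumnHom_mem_symplecticInt_iff.2 fun a _ => ?_⟩
      rw [toAdd_ofAdd]; exact hgK _ _
    -- `x⁻¹ g` has trivial columns `≥ k`
    have hg' : x⁻¹ * g ∈ ⨆ (j : Fin n) (_ : (j : ℕ) < k), leviColumnBall n K j (0 : Fin n → ℤ) := by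
      refine ih hkn.le (Subgroup.mul_mem _ (Subgroup.inv_mem _ hxU) hg) (fun a b => ?_) (fun a b hb => ?_)
      · rw [hx, leviColumnHom_inv_mul_apply_inr, hC, hC, mul_zero, ite_self, sub_zero]
      · rw [hx, leviColumnHom_inv_mul_apply_inr]
        rcases (show k ≤ (b : ℕ) from hb).eq_or_lt with hbk | hbk
        · -- `b = κ`
          have hbκ : b = κ := Fin.ext hbk.symm
          subst hbκ
          rw [hgU.2]
          rcases lt_trichotomy a κ with ha | ha | ha
          · rw [if_pos ha, mul_one, Matrix.one_apply_ne (ne_of_lt ha)]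
            exact sub_self _
          · rw [ha, if_neg (lt_irrefl _), sub_zero, Matrix.one_apply_eq, hgU.2]
          · rw [if_neg (not_lt.2 ha.le), sub_zero, Matrix.one_apply_ne (ne_of_gt ha)]
            exact ((blockTriangular_symplecticBorelOrder_iff _).1 (mem_symplecticBorel_iff.1 hgB)).2.1 a κ ha
        · -- `b > κ`
          have hκb : κ ≠ b := fun h => by rw [← h] at hbk; exact lt_irrefl _ hbk
          rw [hD a b hbk, hD κ b hbk, Matrix.one_apply_ne hκb, mul_zero, ite_self, sub_zero]
    have hmono : (⨆ (j : Fin n) (_ : (j : ℕ) < k), leviColumnBall n K j (0 : Fin n → ℤ)) ≤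
        ⨆ (j : Fin n) (_ : (j : ℕ) < k + 1), leviColumnBall n K j (0 : Fin n → ℤ) :=
      iSup_mono fun j => iSup_le fun hj => le_iSup_of_le (Nat.lt_succ_of_lt hj) le_rfl
    have hxmem : x ∈ ⨆ (j : Fin n) (_ : (j : ℕ) < k + 1), leviColumnBall n K j (0 : Fin n → ℤ) :=
      Subgroup.mem_iSup_of_mem κ (Subgroup.mem_iSup_of_mem (Nat.lt_succ_self k) hxX)
    have e : g = x * (x⁻¹ * g) := by rw [mul_inv_cancel_left]
    rw [e]
    exact Subgroup.mul_mem _ hxmem (hmono hg')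

/-- **`U(K) ∩ Sp_{2n}(𝒪) = N(0) ⊔ ⨆_k X_k(0)`**: the integral unipotent radical is generated by the integral Siegel part
and the integral Levi column groups. [cite: AndrianovZhuravlev1995, Ch. 1 §3 Prop. 3.7; Ch. 3 §3 Lemma 3.4]
[cite: Macdonald1995, Ch. V (2.6)] [cite: BruhatTits1972, §6.1] -/
theorem unipotentInt_eq_sup :
    symplecticUnipotent n K ⊓ symplecticInt (Fin n) K =
      siegelLowerBall n K (0 : Fin n → ℤ) ⊔ ⨆ k : Fin n, leviColumnBall n K k (0 : Fin n → ℤ) := by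
  refine le_antisymm (fun g hg => ?_) (sup_le ?_ (iSup_le fun k => ?_))
  · obtain ⟨c, hc, hC⟩ := exists_siegelLowerHom_inv_mul_apply_eq_zero hg
    set u := siegelLowerHom n K (Multiplicative.ofAdd c) with hu
    have huN : u ∈ siegelLowerBall n K (0 : Fin n → ℤ) := by
      refine siegelLowerHom_mem_siegelLowerBall fun a b hab => ?_
      rw [Pi.zero_apply, Pi.zero_apply, add_zero, WithZero.exp_zero]
      exact hc a b hab
    have huU : u ∈ symplecticUnipotent n K ⊓ symplecticInt (Fin n) K := by
      refine Subgroup.mem_inf.2 ⟨siegelLowerHom_mem_symplecticUnipotent _, siegelLowerHom_mem_symplecticInt_iff.2 fun a b hab => ?_⟩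
      rw [toAdd_ofAdd]; exact hc a b hab
    have hg' : u⁻¹ * g ∈ ⨆ (j : Fin n) (_ : (j : ℕ) < n), leviColumnBall n K j (0 : Fin n → ℤ) :=
      mem_iSup_leviColumnBall_of_columns_trivial n le_rfl (Subgroup.mul_mem _ (Subgroup.inv_mem _ huU) hg) hC
        (fun a b hb => absurd b.2 (not_lt.2 hb))
    simp only [Fin.is_lt, iSup_pos] at hg'
    have e : g = u * (u⁻¹ * g) := by rw [mul_inv_cancel_left]
    rw [e]
    exact Subgroup.mul_mem_sup huN hg'
  · exact le_inf (siegelLowerBall_le_symplecticUnipotent _) ((siegelLowerBall_le_borelInt fun _ => le_rfl).trans inf_le_right)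
  · exact le_inf (leviColumnBall_le_symplecticUnipotent _ _) ((leviColumnBall_le_borelInt fun _ _ => le_rfl).trans inf_le_right)

end Generation

/-! ## §9 Torus removal, conjugates of `U(𝒪)` -/

section Torus

variable [Valued K ℤᵐ⁰] {ϖ : K}

/-- **Torus removal `B(𝒪) ⊆ U(𝒪) · t_μB(𝒪)t_μ⁻¹`**: `g = (g d⁻¹) · d` with `d` the diagonal of `g`, `g d⁻¹ ∈ U(𝒪)` and the
diagonal `d ∈ T(𝒪) ⊆ t_μB(𝒪)t_μ⁻¹`. [cite: CartierCorvallis1979, §I.3, §IV (4.2)] [cite: Laumon1995, (4.1.4)] -/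
theorem borelInt_subset_unipotentInt_mul_conjAct {t : symplecticGroup (Fin n) K}
    {μ : Fin n → ℤ} (ht : (t : Matrix (Fin n ⊕ Fin n) (Fin n ⊕ Fin n) K) = Matrix.diagonal fun s => ϖ ^ Sum.elim μ (-μ) s) :
    ((symplecticBorel n K ⊓ symplecticInt (Fin n) K : Subgroup (symplecticGroup (Fin n) K)) : Set (symplecticGroup (Fin n) K)) ⊆
      ((symplecticUnipotent n K ⊓ symplecticInt (Fin n) K : Subgroup (symplecticGroup (Fin n) K)) : Set (symplecticGroup (Fin n) K)) *
        ((toConjAct t • (symplecticBorel n K ⊓ symplecticInt (Fin n) K) : Subgroup (symplecticGroup (Fin n) K)) :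
          Set (symplecticGroup (Fin n) K)) := by
  intro g hg
  obtain ⟨hgB, hgK⟩ := Subgroup.mem_inf.1 hg
  have hdiag : ∀ i, (g : Matrix (Fin n ⊕ Fin n) (Fin n ⊕ Fin n) K) (Sum.inl i) (Sum.inl i) *
      (g : Matrix (Fin n ⊕ Fin n) (Fin n ⊕ Fin n) K) (Sum.inr i) (Sum.inr i) = 1 := fun i => by
    rw [mul_comm]; exact apply_inr_mul_apply_inl_eq_one hgB i
  set d : symplecticGroup (Fin n) K :=
    ⟨Matrix.diagonal fun s => (g : Matrix (Fin n ⊕ Fin n) (Fin n ⊕ Fin n) K) s s,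
      diagonal_mem_symplecticGroup (d := fun s => (g : Matrix (Fin n ⊕ Fin n) (Fin n ⊕ Fin n) K) s s) hdiag⟩ with hd
  have hdcoe : (d : Matrix (Fin n ⊕ Fin n) (Fin n ⊕ Fin n) K) =
      Matrix.diagonal fun s => (g : Matrix (Fin n ⊕ Fin n) (Fin n ⊕ Fin n) K) s s := rfl
  have hdB : d ∈ symplecticBorel n K := mem_symplecticBorel_of_coe_eq_diagonal hdcoe
  have hdK : d ∈ symplecticInt (Fin n) K := mem_symplecticInt_iff.2 fun s s' => by
    rw [hdcoe, Matrix.diagonal_apply]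
    split_ifs
    · exact hgK s s
    · rw [map_zero]; exact zero_le
  -- `d` commutes with `t`
  have hcomm : d * t = t * d := by
    refine Subtype.ext ?_
    rw [Submonoid.coe_mul, Submonoid.coe_mul, hdcoe, ht, Matrix.diagonal_mul_diagonal, Matrix.diagonal_mul_diagonal]
    congr 1
    funext s
    exact mul_comm _ _
  have hdt : d ∈ toConjAct t • (symplecticBorel n K ⊓ symplecticInt (Fin n) K) := by
    rw [Subgroup.mem_pointwise_smul_iff_inv_smul_mem, ← toConjAct_inv, toConjAct_smul, inv_inv, mul_assoc, hcomm,
      inv_mul_cancel_left]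
    exact Subgroup.mem_inf.2 ⟨hdB, hdK⟩
  -- `g d⁻¹` is unipotent
  have huB : g * d⁻¹ ∈ symplecticBorel n K := (symplecticBorel n K).mul_mem hgB ((symplecticBorel n K).inv_mem hdB)
  have hu : g * d⁻¹ ∈ symplecticUnipotent n K ⊓ symplecticInt (Fin n) K := by
    refine Subgroup.mem_inf.2 ⟨⟨huB, fun i => ?_⟩, (symplecticInt (Fin n) K).mul_mem hgK ((symplecticInt (Fin n) K).inv_mem hdK)⟩
    have h := blockTriangular_mul_apply_self (K := K) symplecticBorelOrder_injective huB hdB (Sum.inr i)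
    rw [← Submonoid.coe_mul, inv_mul_cancel_right, hdcoe, Matrix.diagonal_apply_eq] at h
    have hne := apply_inr_ne_zero hgB i
    have h' : (1 : K) * (g : Matrix (Fin n ⊕ Fin n) (Fin n ⊕ Fin n) K) (Sum.inr i) (Sum.inr i) =
        ((g * d⁻¹ : symplecticGroup (Fin n) K) : Matrix (Fin n ⊕ Fin n) (Fin n ⊕ Fin n) K) (Sum.inr i) (Sum.inr i) *
          (g : Matrix (Fin n ⊕ Fin n) (Fin n ⊕ Fin n) K) (Sum.inr i) (Sum.inr i) := by rw [one_mul]; exact h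
    exact (mul_right_cancel₀ hne h').symm
  exact Set.mem_mul.2 ⟨g * d⁻¹, hu, d, hdt, by rw [inv_mul_cancel_right]⟩

/-- **`U(𝒪) ∩ t_μB(𝒪)t_μ⁻¹ = U(𝒪) ∩ t_μU(𝒪)t_μ⁻¹`**: conjugation by `t_μ` preserves the diagonal. [cite: CartierCorvallis1979, §IV (4.2)] -/
theorem unipotentInt_inf_conjAct_borelInt_eq (hϖ : Valued.v ϖ = WithZero.exp (-1 : ℤ)) {t : symplecticGroup (Fin n) K}
    {μ : Fin n → ℤ} (ht : (t : Matrix (Fin n ⊕ Fin n) (Fin n ⊕ Fin n) K) = Matrix.diagonal fun s => ϖ ^ Sum.elim μ (-μ) s) :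
    (symplecticUnipotent n K ⊓ symplecticInt (Fin n) K) ⊓ toConjAct t • (symplecticBorel n K ⊓ symplecticInt (Fin n) K) =
      (symplecticUnipotent n K ⊓ symplecticInt (Fin n) K) ⊓ toConjAct t • (symplecticUnipotent n K ⊓ symplecticInt (Fin n) K) := by
  refine le_antisymm (fun g hg => ?_) (inf_le_inf_left _ (Subgroup.pointwise_smul_le_pointwise_smul_iff.2
    (inf_le_inf_right _ symplecticUnipotent_le_symplecticBorel)))
  obtain ⟨hgU, hgt⟩ := Subgroup.mem_inf.1 hg
  refine Subgroup.mem_inf.2 ⟨hgU, ?_⟩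
  rw [Subgroup.mem_pointwise_smul_iff_inv_smul_mem, ← toConjAct_inv, toConjAct_smul] at hgt ⊢
  obtain ⟨hB, hK⟩ := Subgroup.mem_inf.1 hgt
  refine Subgroup.mem_inf.2 ⟨⟨hB, fun i => ?_⟩, hK⟩
  rw [coe_conj_apply_of_coe_eq_diagonal_zpow (uniformizer_ne_zero hϖ) (coe_inv_eq_diagonal_zpow_neg hϖ ht), sub_self,
    zpow_zero, one_mul]
  exact (Subgroup.mem_inf.1 hgU).1.2 i

/-- **Antidominant `t_μ` contract `U(𝒪)`**: for `μ` monotone and `≤ 0`, `t_μU(𝒪)t_μ⁻¹ ≤ U(𝒪)`.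
[cite: BruhatTits1972, (4.4.4)] [cite: CartierCorvallis1979, §IV (4.2)] -/
theorem conjAct_smul_unipotentInt_le (hϖ : Valued.v ϖ = WithZero.exp (-1 : ℤ)) {t : symplecticGroup (Fin n) K}
    {μ : Fin n → ℤ} (ht : (t : Matrix (Fin n ⊕ Fin n) (Fin n ⊕ Fin n) K) = Matrix.diagonal fun s => ϖ ^ Sum.elim μ (-μ) s)
    (hμ : Monotone μ) (hμ0 : ∀ i, μ i ≤ 0) :
    toConjAct t • (symplecticUnipotent n K ⊓ symplecticInt (Fin n) K) ≤ symplecticUnipotent n K ⊓ symplecticInt (Fin n) K := by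
  intro g hg
  rw [Subgroup.mem_smul_pointwise_iff_exists] at hg
  obtain ⟨u, hu, rfl⟩ := hg
  obtain ⟨huU, huK⟩ := Subgroup.mem_inf.1 hu
  have hmem : toConjAct t • u ∈ symplecticBorel n K ⊓ symplecticInt (Fin n) K :=
    conjAct_smul_inf_le_of_monotone_nonpos_symplectic hϖ ht hμ hμ0
      (Subgroup.smul_mem_pointwise_smul _ _ _ (Subgroup.mem_inf.2 ⟨huU.1, huK⟩))
  obtain ⟨hB, hK⟩ := Subgroup.mem_inf.1 hmem
  refine Subgroup.mem_inf.2 ⟨⟨hB, fun i => ?_⟩, hK⟩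
  rw [toConjAct_smul, coe_conj_apply_of_coe_eq_diagonal_zpow (uniformizer_ne_zero hϖ) ht, sub_self, zpow_zero, one_mul]
  exact huU.2 i

omit [Valued K ℤᵐ⁰] in
/-- Pointwise conjugation distributes over `⨆`. [folklore] -/
private theorem conjAct_smul_iSup {ι : Type*} (a : ConjAct (symplecticGroup (Fin n) K))
    (S : ι → Subgroup (symplecticGroup (Fin n) K)) : a • (⨆ i, S i) = ⨆ i, a • S i := by
  simp only [Subgroup.pointwise_smul_def, Subgroup.map_iSup]

/-- **`t_μ (N(ν) ⊔ ⨆_k X_k(ν)) t_μ⁻¹ = N(ν + μ) ⊔ ⨆_k X_k(ν + μ)`**. [cite: BruhatTits1972, (4.4.3), §6.1] -/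
theorem conjAct_smul_unipotentBall (hϖ : Valued.v ϖ = WithZero.exp (-1 : ℤ)) {t : symplecticGroup (Fin n) K}
    {μ : Fin n → ℤ} (ht : (t : Matrix (Fin n ⊕ Fin n) (Fin n ⊕ Fin n) K) = Matrix.diagonal fun s => ϖ ^ Sum.elim μ (-μ) s)
    (ν : Fin n → ℤ) :
    toConjAct t • (siegelLowerBall n K ν ⊔ ⨆ k : Fin n, leviColumnBall n K k ν) =
      siegelLowerBall n K (ν + μ) ⊔ ⨆ k : Fin n, leviColumnBall n K k (ν + μ) := by
  rw [Subgroup.smul_sup, conjAct_smul_siegelLowerBall hϖ ht, conjAct_smul_iSup]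
  simp only [conjAct_smul_leviColumnBall hϖ ht]

/-- **`t_μ U(𝒪) t_μ⁻¹ = N(μ) ⊔ ⨆_k X_k(μ)`** (generation + weight shift). [cite: BruhatTits1972, (4.4.3), §6.1]
[cite: Macdonald1995, Ch. V (2.6)] -/
theorem conjAct_smul_unipotentInt_eq (hϖ : Valued.v ϖ = WithZero.exp (-1 : ℤ)) {t : symplecticGroup (Fin n) K}
    {μ : Fin n → ℤ} (ht : (t : Matrix (Fin n ⊕ Fin n) (Fin n ⊕ Fin n) K) = Matrix.diagonal fun s => ϖ ^ Sum.elim μ (-μ) s) :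
    toConjAct t • (symplecticUnipotent n K ⊓ symplecticInt (Fin n) K) =
      siegelLowerBall n K μ ⊔ ⨆ k : Fin n, leviColumnBall n K k μ := by
  rw [unipotentInt_eq_sup, conjAct_smul_unipotentBall hϖ ht, zero_add]

end Torus

end Literature.NumberTheory.Automorphic.SymplecticCartan

end
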